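import Literature.NumberTheory.NumberFields.CyclicQuinticField2651K2Model
import Literature.NumberTheory.NumberFields.SelmerGroupOddClass
import Literature.NumberTheory.EllipticCurves.TwoDescentParity
import HarnessLib

/-!
# The cyclic quintic field of conductor `2651`, number `2`: the norm-`1` `2`-descent of `480a1`

For `K = CyclicQuintic2651K2.K` (one of the four conductor-`2651` quintic subfields of the field `F₅` of
[DokchitserDokchitser2011RankModN, proof of Thm. 2]): **if `(x, y) ∈ K²`, `y ≠ 0`, lies on
`y² = x(x+2)(x-3)` and `N_{K/ℚ}(x)`, `N_{K/ℚ}(x+2)` are rational squares, then `x` and `x + 2` are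
squares in `K`** (`normDescent`), and its transport `normDescent_of_root` to any quintic field containing
a root of `f`. Here `2` and `3` are inert and `5` SPLITS, `(5) = P₀ P₁ P₂ P₃ P₄`; the argument
extends that of the tree's `CyclicQuinticField11Descent.lean` (all of `2`, `3`, `5` inert there).
The valuations of `x` are even everywhere (parity lemma off `2`, `3` — above `5` it only needs
`v(2) = v(3) = 1`; norm square + `σ`-invariance at `(2)`, `(3)`), so `x = u A²` with a unit
representative `u = rep n` (`Cl(K)[2] = 0`: `CyclicQuinticField2651K2ClassGroup.classNumber_odd` and
the tree's `SelmerGroupOddClass`; `𝓞ˣ/𝓞ˣ² = {rep n}`: `…Units.lean`). The valuation of `x + 2` at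
`Pₖ = ker (ψ5 k : 𝓞 K → ℤ/5)` is even iff `ψ5 k (u)` is a square (`local_five`, a residue computation
on the curve modulo `Pₖ`); with the generators `βₖ = σᵏ β` of `Pₖ⁵` from the fifth-power certificate
(`β ∈ ker h5`, `N(β) = -5⁵`) this gives `x + 2 = u' · ∏ βₖ^{cₖ} · W²`, `c = cmOf n` the non-square
pattern of `(ψ5 k (rep n))ₖ` and `u' = rep (nB c)` pinned down by the total positivity of `x + 2` and
the real signs of the `βₖ`. Finally the `2`-adic obstruction modulo `4` (the finite ring `Q4 = 𝓞 K/4`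
of `…Model.lean`, the twisted classes `wQ n = red4 (u' ∏ βₖ^{cₖ})` and the kernel check `k2_check`
below) excludes every `n ≠ 0`, and `n = 0` gives `c = 0`, `x = A²`, `x + 2 = W²`. Everything is
PROVED; no facts.

## References

* J. H. Silverman, *The Arithmetic of Elliptic Curves*, 2nd ed., GTM 106 (2009), Ch. X §1,
  Prop. X.1.4, Thm. X.1.1. [SilvermanAEC2009]
* T. Dokchitser, V. Dokchitser, *A note on the Mordell–Weil rank modulo n*, J. Number Theory 131
  (2011) 1833–1839, proof of Thm. 2. [DokchitserDokchitser2011RankModN]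
-/

noncomputable section

open Polynomial NumberField Algebra Ideal IsDedekindDomain IsDedekindDomain.HeightOneSpectrum
open scoped WithZero

namespace Literature.NumberTheory.NumberFields

namespace CyclicQuintic2651K2

open QuinticCert

/-- `Q2 = R/2R = 𝔽₃₂`. [folklore] -/
abbrev Q2 : Type := TAlg spec (ZMod 2)

/-! ### The inert places `(2)`, `(3)` as points of `HeightOneSpectrum` -/

/-- **The prime `v₂ = (2)`.** [folklore] -/
def v₂ : HeightOneSpectrum (𝓞 K) := ⟨span {(2 : 𝓞 K)}, span_two.1.isPrime, by
  rw [Ne, span_singleton_eq_bot]; norm_num⟩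

/-- **The prime `v₃ = (3)`.** [folklore] -/
def v₃ : HeightOneSpectrum (𝓞 K) := ⟨span {(3 : 𝓞 K)}, span_three.1.isPrime, by
  rw [Ne, span_singleton_eq_bot]; norm_num⟩

/-- A point of the height-one spectrum containing `2` is `v₂`. [folklore] -/
theorem eq_v₂_of_mem {v : HeightOneSpectrum (𝓞 K)} (h : (2 : 𝓞 K) ∈ v.asIdeal) : v = v₂ :=
  HeightOneSpectrum.ext (span_two.2 v.asIdeal v.isPrime (by exact_mod_cast h))

/-- A point of the height-one spectrum containing `3` is `v₃`. [folklore] -/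
theorem eq_v₃_of_mem {v : HeightOneSpectrum (𝓞 K)} (h : (3 : 𝓞 K) ∈ v.asIdeal) : v = v₃ :=
  HeightOneSpectrum.ext (span_three.2 v.asIdeal v.isPrime (by exact_mod_cast h))

/-- **Valuations of rational integers**: `v(n) = 1` unless `n ∈ v`. [folklore] -/
theorem valuation_natCast_eq_one_iff (v : HeightOneSpectrum (𝓞 K)) (n : ℕ) :
    v.valuation K (n : K) = 1 ↔ (n : 𝓞 K) ∉ v.asIdeal := by
  rw [show (n : K) = algebraMap (𝓞 K) K n by simp, valuation_of_algebraMap, intValuation_eq_one_iff]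

/-- `v(n) ≤ 1` for a natural number `n`. [folklore] -/
theorem valuation_natCast_le_one (v : HeightOneSpectrum (𝓞 K)) (n : ℕ) : v.valuation K (n : K) ≤ 1 := by
  rw [show (n : K) = algebraMap (𝓞 K) K n by simp]; exact valuation_le_one v _
/-! ### The invariance of the inert valuations under `σ`; norm parity -/

/-- **A ring automorphism of `𝓞 K` does not increase the valuation at an inert prime `(p)`**: it
preserves divisibility by `pⁿ`. (Verbatim the tree's `CyclicCubic13.intValuation_ringEquiv_le`.)
[folklore] -/
theorem intValuation_ringEquiv_le (v : HeightOneSpectrum (𝓞 K)) {p : ℕ} (hv : v.asIdeal = span {(p : 𝓞 K)})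
    (τ : 𝓞 K ≃+* 𝓞 K) (a : 𝓞 K) : v.intValuation (τ a) ≤ v.intValuation a := by
  by_cases ha : a = 0
  · simp [ha]
  have key : ∀ (b : 𝓞 K) (n : ℕ), v.intValuation b ≤ WithZero.exp (-(n : ℤ)) ↔ (p : 𝓞 K) ^ n ∣ b := by
    intro b n
    rw [intValuation_le_pow_iff_dvd, hv, Ideal.span_singleton_pow, dvd_span_singleton,
      Ideal.mem_span_singleton]
  have hva : v.intValuation a ≠ 0 := intValuation_ne_zero v a ha
  obtain ⟨m, hm⟩ : ∃ m : ℕ, v.intValuation a = WithZero.exp (-(m : ℤ)) := by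
    have hle : WithZero.log (v.intValuation a) ≤ 0 := by
      rw [← WithZero.log_one]
      exact (WithZero.log_le_log hva one_ne_zero).mpr (intValuation_le_one v a)
    refine ⟨(-WithZero.log (v.intValuation a)).toNat, ?_⟩
    rw [Int.toNat_of_nonneg (by omega), neg_neg, WithZero.exp_log hva]
  rw [hm, key]
  have h := (key a m).mp hm.le
  simpa using map_dvd τ h

/-- Hence `v_{(p)}(τ a) = v_{(p)}(a)` for a ring automorphism `τ` of `𝓞 K` and an inert `p`.
[folklore] -/
theorem intValuation_ringEquiv_eq (v : HeightOneSpectrum (𝓞 K)) {p : ℕ} (hv : v.asIdeal = span {(p : 𝓞 K)})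
    (τ : 𝓞 K ≃+* 𝓞 K) (a : 𝓞 K) : v.intValuation (τ a) = v.intValuation a := by
  refine le_antisymm (intValuation_ringEquiv_le v hv τ a) ?_
  have := intValuation_ringEquiv_le v hv τ.symm (τ a)
  rwa [τ.symm_apply_apply] at this

/-- **`σ` preserves the valuation of `K` at an inert prime `(p)`.** [folklore] -/
theorem valuation_σ_eq (v : HeightOneSpectrum (𝓞 K)) {p : ℕ} (hv : v.asIdeal = span {(p : 𝓞 K)}) (z : K) :
    v.valuation K (σ z) = v.valuation K z := by
  obtain ⟨a, b, hb, rfl⟩ := IsFractionRing.div_surjective (A := 𝓞 K) z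
  have e : σ (algebraMap (𝓞 K) K a / algebraMap (𝓞 K) K b) =
      algebraMap (𝓞 K) K (σint a) / algebraMap (𝓞 K) K (σint b) := by
    rw [map_div₀]; rfl
  rw [e, map_div₀, map_div₀, valuation_of_algebraMap, valuation_of_algebraMap, valuation_of_algebraMap,
    valuation_of_algebraMap, intValuation_ringEquiv_eq v hv, intValuation_ringEquiv_eq v hv]

/-- The same for the iterates `σⁱ`. [folklore] -/
theorem valuation_σ_iterate_eq (v : HeightOneSpectrum (𝓞 K)) {p : ℕ} (hv : v.asIdeal = span {(p : 𝓞 K)})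
    (n : ℕ) (z : K) : v.valuation K (σ^[n] z) = v.valuation K z := by
  induction n with
  | zero => rfl
  | succ n ih => rw [Function.iterate_succ_apply', valuation_σ_eq v hv, ih]

/-- **Norm parity at an inert prime**: if `N_{K/ℚ}(z)` is the square of a rational number then
`ord_{(p)}(z)` is even, for `p = 2, 3` (inert in `K`): `N(z) = ∏_{i<5} σⁱz` has
`ord_{(p)}(N z) = 5 ord_{(p)}(z)` and `ord_{(p)}(r²) = 2 ord_{(p)}(r)`. [folklore] -/
theorem two_dvd_log_valuation_of_isSquare_norm (v : HeightOneSpectrum (𝓞 K)) {p : ℕ}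
    (hv : v.asIdeal = span {(p : 𝓞 K)}) {z : K} (hz : z ≠ 0) (h : IsSquare (Algebra.norm ℚ z)) :
    (2 : ℤ) ∣ WithZero.log (v.valuation K z) := by
  obtain ⟨r, hr⟩ := h
  have hN := norm_eq_prod_pow_σ z
  rw [hr, map_mul] at hN
  set w := v.valuation K with hw
  have hσz : ∀ i : Fin 5, (σ ^ (i : ℕ)) z ≠ 0 := fun i => (_root_.map_ne_zero _).mpr hz
  have hprod : ∏ i : Fin 5, (σ ^ (i : ℕ)) z ≠ 0 := Finset.prod_ne_zero_iff.mpr fun i _ => hσz i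
  have hr0 : (algebraMap ℚ K r) ≠ 0 := by
    intro h0
    rw [h0, zero_mul] at hN
    exact hprod hN.symm
  have hv0 : w z ≠ 0 := (Valuation.ne_zero_iff _).mpr hz
  have hvr : w (algebraMap ℚ K r) ≠ 0 := (Valuation.ne_zero_iff _).mpr hr0
  have hwi : ∀ i : Fin 5, w ((σ ^ (i : ℕ)) z) = w z := fun i => by
    rw [hw, σ_pow_apply, valuation_σ_iterate_eq v hv]
  have key : WithZero.log (w (algebraMap ℚ K r * algebraMap ℚ K r)) =
      WithZero.log (w (∏ i : Fin 5, (σ ^ (i : ℕ)) z)) := by rw [hN]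
  rw [map_mul, WithZero.log_mul hvr hvr, map_prod] at key
  simp_rw [hwi] at key
  rw [Finset.prod_const, Finset.card_univ, Fintype.card_fin, WithZero.log_pow] at key
  exact ⟨3 * WithZero.log (w z) - WithZero.log (w (algebraMap ℚ K r)), by
    simp only [nsmul_eq_mul, Nat.cast_ofNat] at key; linarith⟩

/-! ### The real places: `x + 2` is totally positive -/

/-- **On the real curve `Y² = X(X+2)(X-3)` with `Y ≠ 0` one has `X + 2 > 0`** (the cubic is positive
exactly on `(-2, 0) ∪ (3, ∞)`). (Verbatim the tree's `CyclicCubic13.real_x_add_two_pos`.) [folklore] -/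
theorem real_x_add_two_pos {X Y : ℝ} (h : Y ^ 2 = X * (X + 2) * (X - 3)) (hY : Y ≠ 0) : 0 < X + 2 := by
  by_contra hle
  rw [not_lt] at hle
  have hX : X ≤ -2 := by linarith
  have h1 : 0 < X * (X - 3) := by nlinarith
  have h2 : X * (X + 2) * (X - 3) = (X + 2) * (X * (X - 3)) := by ring
  have h3 : 0 < Y ^ 2 := lt_of_le_of_ne (sq_nonneg Y) (Ne.symm (pow_ne_zero 2 hY))
  nlinarith

/-- **`x + 2` is positive at every real place** for a `K`-point of `y² = x(x+2)(x-3)` with `y ≠ 0`.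
[folklore] -/
theorem emb_x_add_two_pos {x y : K} (hE : y ^ 2 = x * (x + 2) * (x - 3)) (hy : y ≠ 0) (k : Fin 5) :
    0 < emb k (x + 2) := by
  rw [map_add, map_ofNat]
  refine real_x_add_two_pos (Y := emb k y) ?_ ((_root_.map_ne_zero (emb k)).mpr hy)
  have := congrArg (emb k) hE
  simpa [map_pow, map_mul, map_add, map_sub, map_ofNat] using this

/-! ### `σ` permutes the real places; the signs of the units -/

/-- `emb s (σθ)` is a root of `p`. [folklore] -/
theorem preal_emb_g_one (s : Fin 5) : preal (emb s (g 1)) = 0 := by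
  have h := congrArg (emb s) aeval_g_one
  rw [map_zero, aeval_def, Polynomial.hom_eval₂, RingHom.ext_rat ((emb s).comp (algebraMap ℚ K)) (algebraMap ℚ ℝ),
    eval₂_quinticPolyRat_eq_preal] at h
  exact h

/-- `emb s (σθ) = P₁(r s)/D`. [folklore] -/
theorem emb_g_one_eq_div (s : Fin 5) : emb s (g 1) = ((4972572 : ℝ) + (2637570 : ℝ) * r s + (300510 : ℝ) * r s ^ 2 + (4010 : ℝ) * r s ^ 3 + (-327 : ℝ) * r s ^ 4) / 77285 := by
  simp only [g, map_div₀, map_add, map_mul, map_pow, map_neg, map_ofNat, emb_θ]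

/-- Powers of a real number in a non-negative interval. [folklore] -/
theorem pow_bounds_pos {lo hi x : ℝ} (h0 : 0 ≤ lo) (h1 : lo < x) (h2 : x < hi) :
    lo ^ 2 < x ^ 2 ∧ x ^ 2 < hi ^ 2 ∧ lo ^ 3 < x ^ 3 ∧ x ^ 3 < hi ^ 3 ∧ lo ^ 4 < x ^ 4 ∧ x ^ 4 < hi ^ 4 := by
  have hx : 0 ≤ x := h0.trans h1.le
  exact ⟨pow_lt_pow_left₀ h1 h0 two_ne_zero, pow_lt_pow_left₀ h2 hx two_ne_zero,
    pow_lt_pow_left₀ h1 h0 three_ne_zero, pow_lt_pow_left₀ h2 hx three_ne_zero,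
    pow_lt_pow_left₀ h1 h0 four_ne_zero, pow_lt_pow_left₀ h2 hx four_ne_zero⟩

/-- Powers of a real number in a non-positive interval. [folklore] -/
theorem pow_bounds_neg {lo hi x : ℝ} (h0 : hi ≤ 0) (h1 : lo < x) (h2 : x < hi) :
    hi ^ 2 < x ^ 2 ∧ x ^ 2 < lo ^ 2 ∧ lo ^ 3 < x ^ 3 ∧ x ^ 3 < hi ^ 3 ∧ hi ^ 4 < x ^ 4 ∧ x ^ 4 < lo ^ 4 := by
  have hb := pow_bounds_pos (lo := -hi) (hi := -lo) (x := -x) (by linarith) (by linarith) (by linarith)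
  simp only [neg_sq, Even.neg_pow (by decide : Even 4), Odd.neg_pow (by decide : Odd 3)] at hb
  exact ⟨hb.1, hb.2.1, by linarith [hb.2.2.1], by linarith [hb.2.2.2.1], hb.2.2.2.2.1, hb.2.2.2.2.2⟩

/-- `emb 0 (g 1) = r 3` (`σ` permutes the real places). [folklore] -/
theorem emb_g_one_0 : emb 0 (g 1) = r₃ := by
  have hv := emb_g_one_eq_div 0
  have hs := r₀_spec.1
  simp only [Set.mem_Ioo] at hs
  rw [show r 0 = r₀ from rfl] at hv
  have hb := pow_bounds_neg (show (-1710852311 / 100000000 : ℝ) ≤ 0 by norm_num) hs.1 hs.2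
  norm_num at hb
  rcases root_cases (preal_emb_g_one 0) with h | h | h | h | h
  · exfalso
    have hj := r₀_spec.1
    simp only [Set.mem_Ioo] at hj
    rw [h] at hv
    nlinarith [hj.1, hj.2, hb.1, hb.2.1, hb.2.2.1, hb.2.2.2.1, hb.2.2.2.2.1, hb.2.2.2.2.2, hs.1, hs.2]
  · exfalso
    have hj := r₁_spec.1
    simp only [Set.mem_Ioo] at hj
    rw [h] at hv
    nlinarith [hj.1, hj.2, hb.1, hb.2.1, hb.2.2.1, hb.2.2.2.1, hb.2.2.2.2.1, hb.2.2.2.2.2, hs.1, hs.2]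
  · exfalso
    have hj := r₂_spec.1
    simp only [Set.mem_Ioo] at hj
    rw [h] at hv
    nlinarith [hj.1, hj.2, hb.1, hb.2.1, hb.2.2.1, hb.2.2.2.1, hb.2.2.2.2.1, hb.2.2.2.2.2, hs.1, hs.2]
  · exact h
  · exfalso
    have hj := r₄_spec.1
    simp only [Set.mem_Ioo] at hj
    rw [h] at hv
    nlinarith [hj.1, hj.2, hb.1, hb.2.1, hb.2.2.1, hb.2.2.2.1, hb.2.2.2.2.1, hb.2.2.2.2.2, hs.1, hs.2]

/-- `emb 1 (g 1) = r 4` (`σ` permutes the real places). [folklore] -/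
theorem emb_g_one_1 : emb 1 (g 1) = r₄ := by
  have hv := emb_g_one_eq_div 1
  have hs := r₁_spec.1
  simp only [Set.mem_Ioo] at hs
  rw [show r 1 = r₁ from rfl] at hv
  have hb := pow_bounds_neg (show (-1243749559 / 100000000 : ℝ) ≤ 0 by norm_num) hs.1 hs.2
  norm_num at hb
  rcases root_cases (preal_emb_g_one 1) with h | h | h | h | h
  · exfalso
    have hj := r₀_spec.1
    simp only [Set.mem_Ioo] at hj
    rw [h] at hv
    nlinarith [hj.1, hj.2, hb.1, hb.2.1, hb.2.2.1, hb.2.2.2.1, hb.2.2.2.2.1, hb.2.2.2.2.2, hs.1, hs.2]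
  · exfalso
    have hj := r₁_spec.1
    simp only [Set.mem_Ioo] at hj
    rw [h] at hv
    nlinarith [hj.1, hj.2, hb.1, hb.2.1, hb.2.2.1, hb.2.2.2.1, hb.2.2.2.2.1, hb.2.2.2.2.2, hs.1, hs.2]
  · exfalso
    have hj := r₂_spec.1
    simp only [Set.mem_Ioo] at hj
    rw [h] at hv
    nlinarith [hj.1, hj.2, hb.1, hb.2.1, hb.2.2.1, hb.2.2.2.1, hb.2.2.2.2.1, hb.2.2.2.2.2, hs.1, hs.2]
  · exfalso
    have hj := r₃_spec.1
    simp only [Set.mem_Ioo] at hj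
    rw [h] at hv
    nlinarith [hj.1, hj.2, hb.1, hb.2.1, hb.2.2.1, hb.2.2.2.1, hb.2.2.2.2.1, hb.2.2.2.2.2, hs.1, hs.2]
  · exact h

/-- `emb 2 (g 1) = r 0` (`σ` permutes the real places). [folklore] -/
theorem emb_g_one_2 : emb 2 (g 1) = r₀ := by
  have hv := emb_g_one_eq_div 2
  have hs := r₂_spec.1
  simp only [Set.mem_Ioo] at hs
  rw [show r 2 = r₂ from rfl] at hv
  have hb := pow_bounds_neg (show (-600868148 / 100000000 : ℝ) ≤ 0 by norm_num) hs.1 hs.2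
  norm_num at hb
  rcases root_cases (preal_emb_g_one 2) with h | h | h | h | h
  · exact h
  · exfalso
    have hj := r₁_spec.1
    simp only [Set.mem_Ioo] at hj
    rw [h] at hv
    nlinarith [hj.1, hj.2, hb.1, hb.2.1, hb.2.2.1, hb.2.2.2.1, hb.2.2.2.2.1, hb.2.2.2.2.2, hs.1, hs.2]
  · exfalso
    have hj := r₂_spec.1
    simp only [Set.mem_Ioo] at hj
    rw [h] at hv
    nlinarith [hj.1, hj.2, hb.1, hb.2.1, hb.2.2.1, hb.2.2.2.1, hb.2.2.2.2.1, hb.2.2.2.2.2, hs.1, hs.2]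
  · exfalso
    have hj := r₃_spec.1
    simp only [Set.mem_Ioo] at hj
    rw [h] at hv
    nlinarith [hj.1, hj.2, hb.1, hb.2.1, hb.2.2.1, hb.2.2.2.1, hb.2.2.2.2.1, hb.2.2.2.2.2, hs.1, hs.2]
  · exfalso
    have hj := r₄_spec.1
    simp only [Set.mem_Ioo] at hj
    rw [h] at hv
    nlinarith [hj.1, hj.2, hb.1, hb.2.1, hb.2.2.1, hb.2.2.2.1, hb.2.2.2.2.1, hb.2.2.2.2.2, hs.1, hs.2]

/-- `emb 3 (g 1) = r 1` (`σ` permutes the real places). [folklore] -/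
theorem emb_g_one_3 : emb 3 (g 1) = r₁ := by
  have hv := emb_g_one_eq_div 3
  have hs := r₃_spec.1
  simp only [Set.mem_Ioo] at hs
  rw [show r 3 = r₃ from rfl] at hv
  have hb := pow_bounds_neg (show (-373832423 / 100000000 : ℝ) ≤ 0 by norm_num) hs.1 hs.2
  norm_num at hb
  rcases root_cases (preal_emb_g_one 3) with h | h | h | h | h
  · exfalso
    have hj := r₀_spec.1
    simp only [Set.mem_Ioo] at hj
    rw [h] at hv
    nlinarith [hj.1, hj.2, hb.1, hb.2.1, hb.2.2.1, hb.2.2.2.1, hb.2.2.2.2.1, hb.2.2.2.2.2, hs.1, hs.2]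
  · exact h
  · exfalso
    have hj := r₂_spec.1
    simp only [Set.mem_Ioo] at hj
    rw [h] at hv
    nlinarith [hj.1, hj.2, hb.1, hb.2.1, hb.2.2.1, hb.2.2.2.1, hb.2.2.2.2.1, hb.2.2.2.2.2, hs.1, hs.2]
  · exfalso
    have hj := r₃_spec.1
    simp only [Set.mem_Ioo] at hj
    rw [h] at hv
    nlinarith [hj.1, hj.2, hb.1, hb.2.1, hb.2.2.1, hb.2.2.2.1, hb.2.2.2.2.1, hb.2.2.2.2.2, hs.1, hs.2]
  · exfalso
    have hj := r₄_spec.1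
    simp only [Set.mem_Ioo] at hj
    rw [h] at hv
    nlinarith [hj.1, hj.2, hb.1, hb.2.1, hb.2.2.1, hb.2.2.2.1, hb.2.2.2.2.1, hb.2.2.2.2.2, hs.1, hs.2]

/-- `emb 4 (g 1) = r 2` (`σ` permutes the real places). [folklore] -/
theorem emb_g_one_4 : emb 4 (g 1) = r₂ := by
  have hv := emb_g_one_eq_div 4
  have hs := r₄_spec.1
  simp only [Set.mem_Ioo] at hs
  rw [show r 4 = r₄ from rfl] at hv
  have hb := pow_bounds_pos (show (0:ℝ) ≤ 4029302444 / 100000000 by norm_num) hs.1 hs.2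
  norm_num at hb
  rcases root_cases (preal_emb_g_one 4) with h | h | h | h | h
  · exfalso
    have hj := r₀_spec.1
    simp only [Set.mem_Ioo] at hj
    rw [h] at hv
    nlinarith [hj.1, hj.2, hb.1, hb.2.1, hb.2.2.1, hb.2.2.2.1, hb.2.2.2.2.1, hb.2.2.2.2.2, hs.1, hs.2]
  · exfalso
    have hj := r₁_spec.1
    simp only [Set.mem_Ioo] at hj
    rw [h] at hv
    nlinarith [hj.1, hj.2, hb.1, hb.2.1, hb.2.2.1, hb.2.2.2.1, hb.2.2.2.2.1, hb.2.2.2.2.2, hs.1, hs.2]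
  · exact h
  · exfalso
    have hj := r₃_spec.1
    simp only [Set.mem_Ioo] at hj
    rw [h] at hv
    nlinarith [hj.1, hj.2, hb.1, hb.2.1, hb.2.2.1, hb.2.2.2.1, hb.2.2.2.2.1, hb.2.2.2.2.2, hs.1, hs.2]
  · exfalso
    have hj := r₄_spec.1
    simp only [Set.mem_Ioo] at hj
    rw [h] at hv
    nlinarith [hj.1, hj.2, hb.1, hb.2.1, hb.2.2.1, hb.2.2.2.1, hb.2.2.2.2.1, hb.2.2.2.2.2, hs.1, hs.2]


/-- **The permutation of the real places induced by `σ`.** [folklore] -/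
def π : Fin 5 → Fin 5 := ![3, 4, 0, 1, 2]

/-- `r 0 = r₀`, …. [folklore] -/
theorem r_0 : r 0 = r₀ := rfl
/-- `r 1 = r₁`. [folklore] -/
theorem r_1 : r 1 = r₁ := rfl
/-- `r 2 = r₂`. [folklore] -/
theorem r_2 : r 2 = r₂ := rfl
/-- `r 3 = r₃`. [folklore] -/
theorem r_3 : r 3 = r₃ := rfl
/-- `r 4 = r₄`. [folklore] -/
theorem r_4 : r 4 = r₄ := rfl

/-- **`emb s (σθ) = r (π s)`.** [folklore] -/
theorem emb_g_one (s : Fin 5) : emb s (g 1) = r (π s) := by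
  fin_cases s
  · exact emb_g_one_0
  · exact emb_g_one_1
  · exact emb_g_one_2
  · exact emb_g_one_3
  · exact emb_g_one_4

/-- **`emb s ∘ σ = emb (π s)`** (both send `θ ↦ r (π s)`). [folklore] -/
theorem emb_comp_σ (s : Fin 5) : (emb s).comp (σ : K →+* K) = emb (π s) :=
  ringHom_real_ext (by
    change emb s (σ θ) = emb (π s) θ
    rw [σ_θ, emb_g_one, emb_θ])

/-- `emb s (σ x) = emb (π s) x`. [folklore] -/
theorem emb_σ (s : Fin 5) (x : K) : emb s (σ x) = emb (π s) x :=
  DFunLike.congr_fun (emb_comp_σ s) x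

/-- Iterates: `emb s (σᵏ x) = emb (πᵏ s) x`. [folklore] -/
theorem emb_σ_iterate (k : ℕ) (s : Fin 5) (x : K) : emb s (σ^[k] x) = emb (π^[k] s) x := by
  induction k generalizing s x with
  | zero => rfl
  | succ k ih => rw [Function.iterate_succ_apply, Function.iterate_succ_apply', ih, emb_σ]

/-- `emb s (g b) = r (πᵇ s)`. [folklore] -/
theorem emb_g (s b : Fin 5) : emb s (g b) = r (π^[(b : ℕ)] s) := by
  rw [← σ_iterate_θ, emb_σ_iterate, emb_θ]

/-- **`emb s (Σ y_b g_b) = Σ y_b r_(πᵇ s)`.** [folklore] -/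
theorem emb_liftK (s : Fin 5) (y : R) : emb s (liftK y) = ∑ b, (y.coef b : ℝ) * r (π^[(b : ℕ)] s) := by
  rw [liftK, TableSpec.lift_apply, map_sum]
  refine Finset.sum_congr rfl fun b _ => ?_
  rw [map_mul, map_intCast, emb_g]

/-- The conjugates `shiftⁱ v` (computed externally, verified below). [folklore] -/
def shiftTab : Fin 5 → R := ![⟨![-2317, -2556, -2344, -2296, -2357]⟩, ⟨![-2357, -2317, -2556, -2344, -2296]⟩, ⟨![-2296, -2357, -2317, -2556, -2344]⟩, ⟨![-2344, -2296, -2357, -2317, -2556]⟩, ⟨![-2556, -2344, -2296, -2357, -2317]⟩]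

/-- `shiftⁱ v = shiftTab i` (kernel computation). [folklore] -/
theorem shift_iterate_vP : ∀ i : Fin 5, shift^[(i : ℕ)] vP = shiftTab i := by
  decide +kernel

/-- **`∏ₛ emb s z = N(z)`**: the norm is the product over the real places. [folklore] -/
theorem prod_emb_eq_norm (z : K) : ∏ s : Fin 5, emb s z = Algebra.norm ℚ z := by
  have h := congrArg (emb 0) (norm_eq_prod_pow_σ z)
  rw [map_prod] at h
  have h' : (emb 0) (algebraMap ℚ K (Algebra.norm ℚ z)) = (Algebra.norm ℚ z : ℝ) := by
    rw [← RingHom.comp_apply, RingHom.ext_rat ((emb 0).comp (algebraMap ℚ K)) (algebraMap ℚ ℝ)]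
    rfl
  rw [h'] at h
  rw [h]
  have hperm : ∀ i : Fin 5, emb 0 ((σ ^ (i : ℕ)) z) = emb (π^[(i : ℕ)] 0) z := fun i => by
    rw [σ_pow_apply, emb_σ_iterate]
  simp_rw [hperm]
  symm
  refine Finset.prod_nbij (fun i : Fin 5 => π^[(i : ℕ)] 0) (fun _ _ => Finset.mem_univ _) ?_ ?_ (fun _ _ => rfl)
  · intro i _ i' _ h
    have key : ∀ a b : Fin 5, π^[(a : ℕ)] 0 = π^[(b : ℕ)] 0 → a = b := by decide
    exact key i i' h
  · intro t _
    have key : ∀ t : Fin 5, ∃ i : Fin 5, π^[(i : ℕ)] 0 = t := by decide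
    obtain ⟨i, hi⟩ := key t
    exact ⟨i, Finset.mem_univ _, hi⟩

/-- `emb s v = Σ_b v_b r_(πᵇ s)`. [folklore] -/
theorem emb_vK_eq (s : Fin 5) : emb s (liftK vP) = ∑ b, (vP.coef b : ℝ) * r (π^[(b : ℕ)] s) := emb_liftK s vP

/-- The real signs of `v` (computed externally, verified below). [folklore] -/
def sgnv5 : Fin 5 → SignType := ![-1, -1, -1, 1, 1]

/-- **The signs of `v` at the five real places** (linear interval arithmetic on the roots; a place
where `|emb s v|` is below the precision of the root brackets is recovered from
`∏ₛ emb s v = N(v)`). [folklore] -/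
theorem sign_emb_vK : ∀ s : Fin 5, SignType.sign (emb s (liftK vP)) = sgnv5 s := by
  have h0 := r₀_spec.1; have h1 := r₁_spec.1; have h2 := r₂_spec.1; have h3 := r₃_spec.1
  have h4 := r₄_spec.1
  simp only [Set.mem_Ioo] at h0 h1 h2 h3 h4
  have hev : ∀ s : Fin 5, emb s (liftK vP) = ∑ b, (vP.coef b : ℝ) * r (π^[(b : ℕ)] s) := emb_vK_eq
  have e0 : SignType.sign (emb 0 (liftK vP)) = -1 := by
    have e : emb 0 (liftK vP) = (-2317 : ℝ) * r₀ + (-2556 : ℝ) * r₃ + (-2344 : ℝ) * r₁ + (-2296 : ℝ) * r₄ + (-2357 : ℝ) * r₂ := by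
      rw [hev, Fin.sum_univ_five]
      simp only [vP, π, Fin.isValue, Matrix.cons_val_zero, Matrix.cons_val_one, Matrix.head_cons, Matrix.cons_val_two,
        Matrix.tail_cons, Matrix.cons_val_three, Matrix.cons_val_four, Function.iterate_succ_apply',
        Function.iterate_zero_apply, Fin.val_zero, Fin.val_one, Fin.val_two, show ((3 : Fin 5) : ℕ) = 3 from rfl,
        show ((4 : Fin 5) : ℕ) = 4 from rfl, r_0, r_1, r_2, r_3, r_4, Int.cast_ofNat, Int.cast_neg]
    rw [e]
    exact sign_neg (by linarith)
  have e1 : SignType.sign (emb 1 (liftK vP)) = -1 := by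
    have e : emb 1 (liftK vP) = (-2317 : ℝ) * r₁ + (-2556 : ℝ) * r₄ + (-2344 : ℝ) * r₂ + (-2296 : ℝ) * r₀ + (-2357 : ℝ) * r₃ := by
      rw [hev, Fin.sum_univ_five]
      simp only [vP, π, Fin.isValue, Matrix.cons_val_zero, Matrix.cons_val_one, Matrix.head_cons, Matrix.cons_val_two,
        Matrix.tail_cons, Matrix.cons_val_three, Matrix.cons_val_four, Function.iterate_succ_apply',
        Function.iterate_zero_apply, Fin.val_zero, Fin.val_one, Fin.val_two, show ((3 : Fin 5) : ℕ) = 3 from rfl,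
        show ((4 : Fin 5) : ℕ) = 4 from rfl, r_0, r_1, r_2, r_3, r_4, Int.cast_ofNat, Int.cast_neg]
    rw [e]
    exact sign_neg (by linarith)
  have e2 : SignType.sign (emb 2 (liftK vP)) = -1 := by
    have e : emb 2 (liftK vP) = (-2317 : ℝ) * r₂ + (-2556 : ℝ) * r₀ + (-2344 : ℝ) * r₃ + (-2296 : ℝ) * r₁ + (-2357 : ℝ) * r₄ := by
      rw [hev, Fin.sum_univ_five]
      simp only [vP, π, Fin.isValue, Matrix.cons_val_zero, Matrix.cons_val_one, Matrix.head_cons, Matrix.cons_val_two,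
        Matrix.tail_cons, Matrix.cons_val_three, Matrix.cons_val_four, Function.iterate_succ_apply',
        Function.iterate_zero_apply, Fin.val_zero, Fin.val_one, Fin.val_two, show ((3 : Fin 5) : ℕ) = 3 from rfl,
        show ((4 : Fin 5) : ℕ) = 4 from rfl, r_0, r_1, r_2, r_3, r_4, Int.cast_ofNat, Int.cast_neg]
    rw [e]
    exact sign_neg (by linarith)
  have e3 : SignType.sign (emb 3 (liftK vP)) = 1 := by
    have e : emb 3 (liftK vP) = (-2317 : ℝ) * r₃ + (-2556 : ℝ) * r₁ + (-2344 : ℝ) * r₄ + (-2296 : ℝ) * r₂ + (-2357 : ℝ) * r₀ := by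
      rw [hev, Fin.sum_univ_five]
      simp only [vP, π, Fin.isValue, Matrix.cons_val_zero, Matrix.cons_val_one, Matrix.head_cons, Matrix.cons_val_two,
        Matrix.tail_cons, Matrix.cons_val_three, Matrix.cons_val_four, Function.iterate_succ_apply',
        Function.iterate_zero_apply, Fin.val_zero, Fin.val_one, Fin.val_two, show ((3 : Fin 5) : ℕ) = 3 from rfl,
        show ((4 : Fin 5) : ℕ) = 4 from rfl, r_0, r_1, r_2, r_3, r_4, Int.cast_ofNat, Int.cast_neg]
    rw [e]
    exact sign_pos (by linarith)
  have hN : ∏ s : Fin 5, emb s (liftK vP) = -1 := by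
    rw [prod_emb_eq_norm, norm_liftK_of_normT_eq normT_vP]; norm_num
  have hsv : SignType.sign ((-1 : ℝ)) = -1 := by rw [Left.sign_neg, sign_one]
  have et : SignType.sign (emb 4 (liftK vP)) = 1 := by
    have hs : SignType.sign (∏ s : Fin 5, emb s (liftK vP)) = ∏ s : Fin 5, SignType.sign (emb s (liftK vP)) :=
      map_prod signHom _ _
    rw [hN, hsv, Fin.prod_univ_five, e0, e1, e2, e3] at hs
    revert hs
    generalize SignType.sign (emb 4 (liftK vP)) = σt
    revert σt
    decide
  intro s
  fin_cases s
  · exact e0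
  · exact e1
  · exact e2
  · exact e3
  · exact et

/-- `σⁱ v` in `K` is `σⁱ` of `v`. [folklore] -/
theorem coe_unitv_eq (i : Fin 5) : (((unitv i : (𝓞 K)ˣ) : 𝓞 K) : K) = σ^[(i : ℕ)] (liftK vP) := by
  rw [coe_unitv, coe_liftO, σ_iterate_liftK]

/-- The real signs of the conjugate units: `sgnTab i s = sign (emb s (σⁱ v)) = sgnv5 (πⁱ s)`. [folklore] -/
def sgnTab (i s : Fin 5) : SignType := sgnv5 (π^[(i : ℕ)] s)

/-- **The signs of the conjugate units at the real places.** [folklore] -/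
theorem sign_emb_unitv (i s : Fin 5) : SignType.sign (emb s (((unitv i : (𝓞 K)ˣ) : 𝓞 K) : K)) = sgnTab i s := by
  rw [coe_unitv_eq, emb_σ_iterate, sign_emb_vK, sgnTab]

/-- The real sign vector of a field element. [folklore] -/
def sgn5 (z : K) : Fin 5 → SignType := fun s => SignType.sign (emb s z)

/-- `sgn5` is multiplicative. [folklore] -/
theorem sgn5_mul (z z' : K) : sgn5 (z * z') = sgn5 z * sgn5 z' := by
  ext s; simp [sgn5, sign_mul]

/-- The predicted sign vector of `rep n`. [folklore] -/
def sgnOf (n : Fin 32) (s : Fin 5) : SignType :=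
  (-1) ^ bit n 4 * (sgnTab 0 s ^ bit n 0 * sgnTab 1 s ^ bit n 1 * sgnTab 2 s ^ bit n 2 * sgnTab 3 s ^ bit n 3)

/-- **`sgn5 (rep n) = sgnOf n`.** [folklore] -/
theorem sgn5_rep (n : Fin 32) : sgn5 ((((rep n : (𝓞 K)ˣ) : 𝓞 K) : K)) = sgnOf n := by
  ext s
  rw [rep, Units.val_mul, Units.val_pow_eq_pow_val, Units.val_neg, Units.val_one, Units.coe_prod, Fin.prod_univ_four]
  simp only [Units.val_pow_eq_pow_val, Fin.castSucc_zero, Fin.castSucc_one,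
    show (Fin.castSucc (2 : Fin 4) : Fin 5) = 2 from rfl, show (Fin.castSucc (3 : Fin 4) : Fin 5) = 3 from rfl]
  push_cast
  have hs1 : SignType.sign (-1 : ℝ) = -1 := by rw [Left.sign_neg, sign_one]
  simp only [sgn5, sgnOf, map_mul, map_pow, map_neg, map_one, sign_mul, sign_pow, hs1, sign_emb_unitv]

/-- **A totally positive representative is trivial** (the `32` sign vectors are distinct; kernel check
of the positive one). [folklore] -/
theorem rep_eq_zero_of_pos {n : Fin 32} (h : ∀ k, 0 < emb k ((((rep n : (𝓞 K)ˣ) : 𝓞 K) : K))) : n = 0 := by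
  have key : ∀ n : Fin 32, (∀ s, sgnOf n s = 1) → n = 0 := by decide +kernel
  refine key n fun s => ?_
  have := congrFun (sgn5_rep n) s
  rw [← this]
  exact sign_pos (h s)

/-- **`N(σⁱ v) = -1`.** [folklore] -/
theorem norm_unitv (i : Fin 5) : Algebra.norm ℚ ((((unitv i : (𝓞 K)ˣ) : 𝓞 K) : K)) = -1 := by
  rw [coe_unitv, coe_liftO, ← σ_iterate_liftK, ← σ_pow_apply, Algebra.norm_eq_of_algEquiv,
    norm_liftK_of_normT_eq normT_vP]
  norm_num

/-- `N(-1) = -1` (`[K : ℚ] = 5` is odd). [folklore] -/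
theorem norm_neg_one : Algebra.norm ℚ (-1 : K) = -1 := by
  rw [show (-1 : K) = algebraMap ℚ K (-1) by simp, Algebra.norm_algebraMap, finrank_K]; norm_num

/-- **`N(rep n) = (-1 : ℚ) ^ (∑ i, bit n i)`.** [folklore] -/
theorem norm_rep (n : Fin 32) : Algebra.norm ℚ ((((rep n : (𝓞 K)ˣ) : 𝓞 K) : K)) = (-1 : ℚ) ^ (∑ i, bit n i) := by
  rw [rep, Units.val_mul, Units.val_pow_eq_pow_val, Units.val_neg, Units.val_one, Units.coe_prod, Fin.prod_univ_four]
  simp only [Units.val_pow_eq_pow_val, Fin.castSucc_zero, Fin.castSucc_one,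
    show (Fin.castSucc (2 : Fin 4) : Fin 5) = 2 from rfl, show (Fin.castSucc (3 : Fin 4) : Fin 5) = 3 from rfl]
  push_cast
  simp only [map_mul, map_pow, norm_neg_one, norm_unitv]
  rw [Fin.sum_univ_five]; ring

/-! ### Units and valuations -/

/-- The valuation of a unit of `𝓞 K` is `1` at every finite place. [folklore] -/
theorem valuation_coe_unit (v : HeightOneSpectrum (𝓞 K)) (u : (𝓞 K)ˣ) : v.valuation K (((u : 𝓞 K)) : K) = 1 := by
  rw [RingOfIntegers.coe_eq_algebraMap, valuation_of_algebraMap, intValuation_eq_one_iff]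
  exact fun h => v.isPrime.ne_top (Ideal.eq_top_of_isUnit_mem _ h u.isUnit)

/-- A unit of `𝓞 K` is not in the prime `(2)`. [folklore] -/
theorem unit_not_mem_span_two (u : (𝓞 K)ˣ) : ((u : 𝓞 K)) ∉ span {(2 : 𝓞 K)} := fun h =>
  (span_two.1).ne_top (Ideal.eq_top_of_isUnit_mem _ h u.isUnit)
/-- **`K(∅, 2) = 𝓞ˣ/𝓞ˣ² = {rep n}`**: a non-zero `z ∈ K` all of whose valuations are even is `rep n · w²`
(odd class number: the tree's `exists_isSquare_mul_of_two_dvd_log_valuation_of_odd` with `D = 1`; units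
modulo squares: `exists_eq_rep_mul_sq`). [folklore] -/
theorem exists_rep_mul_sq_of_two_dvd_log_valuation {z : K} (hz : z ≠ 0)
    (hval : ∀ v : HeightOneSpectrum (𝓞 K), (2 : ℤ) ∣ WithZero.log (v.valuation K z)) :
    ∃ (n : Fin 32) (w : K), w ≠ 0 ∧ z = (((rep n : (𝓞 K)ˣ) : 𝓞 K) : K) * w ^ 2 := by
  obtain ⟨u, l, hlG, -, r, hr⟩ :=
    Literature.NumberTheory.NumberFields.exists_isSquare_mul_of_two_dvd_log_valuation_of_odd classNumber_odd (1 : 𝓞 K)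
    List.nil (fun v h1 => absurd (v.asIdeal.eq_top_of_isUnit_mem h1 isUnit_one) v.isPrime.ne_top) hz (fun v _ => hval v)
  have hl : l = List.nil := List.eq_nil_iff_forall_not_mem.mpr fun g hg => by simpa using hlG g hg
  subst hl
  simp only [List.prod_nil] at hr
  rw [show (((1 : 𝓞 K)) : K) = 1 from rfl, mul_one] at hr
  -- `z u = r²`, `u⁻¹ = rep n η²`
  obtain ⟨n, η, hu⟩ := exists_eq_rep_mul_sq u⁻¹
  have hu' : (((u⁻¹ : (𝓞 K)ˣ) : 𝓞 K) : K) = (((rep n : (𝓞 K)ˣ) : 𝓞 K) : K) * ((((η : (𝓞 K)ˣ) : 𝓞 K) : K)) ^ 2 := by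
    rw [hu]; simp only [Units.val_mul, Units.val_pow_eq_pow_val]; push_cast; ring
  have huu : (((u : (𝓞 K)ˣ) : 𝓞 K) : K) * (((u⁻¹ : (𝓞 K)ˣ) : 𝓞 K) : K) = 1 := by
    have h1 : ((((u * u⁻¹ : (𝓞 K)ˣ)) : 𝓞 K) : K) = 1 := by rw [mul_inv_cancel]; rfl
    push_cast at h1
    exact h1
  refine ⟨n, (((η : (𝓞 K)ˣ) : 𝓞 K) : K) * r, ?_, ?_⟩
  · intro h0
    apply hz
    have : z * (((u : (𝓞 K)ˣ) : 𝓞 K) : K) = 0 := by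
      rw [hr]
      rcases mul_eq_zero.mp h0 with h | h
      · exfalso
        exact (RingOfIntegers.coe_ne_zero_iff.mpr (Units.ne_zero η)) h
      · rw [h, mul_zero]
    rcases mul_eq_zero.mp this with h | h
    · exact h
    · exact absurd h (RingOfIntegers.coe_ne_zero_iff.mpr (Units.ne_zero u))
  · calc z = z * ((((u : (𝓞 K)ˣ) : 𝓞 K) : K) * (((u⁻¹ : (𝓞 K)ˣ) : 𝓞 K) : K)) := by rw [huu, mul_one]
      _ = (z * (((u : (𝓞 K)ˣ) : 𝓞 K) : K)) * (((u⁻¹ : (𝓞 K)ˣ) : 𝓞 K) : K) := by ring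
      _ = _ := by rw [hr, hu']; ring

/-! ### The split prime `5`: homomorphisms, the five primes, the generators `βₖ` of `Pₖ⁵` -/

/-- The checker accepts the homomorphism vector of the split prime `5` (root `2`). [folklore] -/
theorem homFor_five_isSome : (CK2.homFor 5 2 (some ⟨2, 1, 3, 1, 4⟩)).isSome = true := by
  decide +kernel

/-- The homomorphism vector of `5`. [folklore] -/
def hom5 : QuinticCert.N5 := (CK2.homFor 5 2 (some ⟨2, 1, 3, 1, 4⟩)).get homFor_five_isSome

/-- `homFor 5 2 _ = some hom5`. [folklore] -/
theorem homFor_five : CK2.homFor 5 2 (some ⟨2, 1, 3, 1, 4⟩) = some hom5 := (Option.some_get homFor_five_isSome).symm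

/-- The entries of `hom5` (kernel evaluation). [folklore] -/
theorem hom5_toFin : ∀ i : Fin 5, hom5.toFin i = (![2, 1, 3, 1, 4] : Fin 5 → ℕ) i := by decide +kernel

/-- The fifth-power homomorphism vector `h5` (`𝓞 K → ℤ/5⁵`). [folklore] -/
def hom55 : QuinticCert.N5 := ⟨312, 286, 1848, 291, 389⟩

/-- `h5` is accepted. [folklore] -/
theorem isHom_55 : CK2.isHom (5 ^ 5) hom55 = true := by decide +kernel

/-- `h5` reduces to `hom5` modulo `5`. [folklore] -/
theorem hom55_reduces : hom55.reducesTo hom5 5 = true := by decide +kernel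

attribute [irreducible] hom5

/-- `5` is prime (instance for `ZMod 5` as a field). [folklore] -/
instance fact_prime_five : Fact (Nat.Prime 5) := ⟨Nat.prime_five⟩

/-- **The five homomorphisms `ψ5 k : 𝓞 K → ℤ/5`** (kernels = the primes above `5`). [folklore] -/
def ψ5 (k : ℕ) : 𝓞 K →+* ZMod 5 :=
  reads.homRot integerEquiv isSymmetry_shiftInv Nat.prime_five.pos (QuinticCert.homFor_spec homFor_five).1 k

/-- Every prime ideal containing `5` is the kernel of some `ψ5 k`. [folklore] -/
theorem exists_eq_ker_ψ5 {Q : Ideal (𝓞 K)} [Q.IsPrime] (h5 : (5 : 𝓞 K) ∈ Q) : ∃ k : Fin 5, Q = RingHom.ker (ψ5 k) := by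
  obtain ⟨k, hk⟩ := reads.exists_eq_ker_homRot integerEquiv isSymmetry_shiftInv finrank_K Nat.prime_five homFor_five
    (Q := Q) (by exact_mod_cast h5)
  exact ⟨k, hk⟩

/-- `ψ5 k` on the integral basis: `ψ5 k (g_b) = h_{b+4k}`. [folklore] -/
theorem ψ5_liftO_basis (k : ℕ) (b : Fin 5) :
    ψ5 k (liftO (TAlg.basis b)) = ((![2, 1, 3, 1, 4] : Fin 5 → ℕ) (b + k • (4 : Fin 5)) : ZMod 5) := by
  rw [ψ5, show liftO (TAlg.basis b) = integerEquiv (TAlg.basis b) from rfl,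
    reads.homRot_basis integerEquiv isSymmetry_shiftInv Nat.prime_five.pos (QuinticCert.homFor_spec homFor_five).1 k b, hom5_toFin]

/-- **`ψ5 k (Σ y_b g_b) = Σ y_b h_{b+4k}`** (a computable formula). [folklore] -/
def ψfun (k : ℕ) (y : R) : ZMod 5 := ∑ b : Fin 5, (y.coef b : ZMod 5) * ((![2, 1, 3, 1, 4] : Fin 5 → ℕ) (b + k • (4 : Fin 5)) : ZMod 5)

/-- `ψ5 k (liftO y) = ψfun k y`. [folklore] -/
theorem ψ5_liftO (k : ℕ) (y : R) : ψ5 k (liftO y) = ψfun k y := by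
  have hy : liftO y = integerEquiv (∑ a, TAlg.const (y.coef a) * TAlg.basis a) := by
    rw [← TAlg.eq_sum_basis]; rfl
  rw [hy, map_sum, map_sum, ψfun]
  refine Finset.sum_congr rfl fun b _ => ?_
  rw [map_mul, map_mul, show TAlg.const (y.coef b) = ((y.coef b : ℤ) : R) by rw [TAlg.intCast_eq_const, Int.cast_id],
    map_intCast, map_intCast, show integerEquiv (TAlg.basis b) = liftO (TAlg.basis b) from rfl, ψ5_liftO_basis]

/-- The points of the height-one spectrum above `5`. [folklore] -/
def v5 (k : Fin 5) : HeightOneSpectrum (𝓞 K) :=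
  ⟨RingHom.ker (ψ5 k), RingHom.ker_isPrime _, fun h0 => by
    have h5 : (5 : 𝓞 K) ∈ RingHom.ker (ψ5 (k : ℕ)) := by
      rw [RingHom.mem_ker, map_ofNat]; decide
    rw [h0, Ideal.mem_bot] at h5
    norm_num at h5⟩

/-- `5 ∈ v5 k`. [folklore] -/
theorem five_mem_v5 (k : Fin 5) : (5 : 𝓞 K) ∈ (v5 k).asIdeal := by
  show (5 : 𝓞 K) ∈ RingHom.ker (ψ5 (k : ℕ))
  rw [RingHom.mem_ker, map_ofNat]; decide

/-- A point of the spectrum containing `5` is some `v5 k`. [folklore] -/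
theorem exists_eq_v5 {v : HeightOneSpectrum (𝓞 K)} (h : (5 : 𝓞 K) ∈ v.asIdeal) : ∃ k, v = v5 k := by
  haveI := v.isPrime
  obtain ⟨k, hk⟩ := exists_eq_ker_ψ5 h
  exact ⟨k, HeightOneSpectrum.ext hk⟩

/-- `ψ5 k` is surjective, so `N(Pₖ) = 5`. [folklore] -/
theorem absNorm_v5 (k : Fin 5) : Ideal.absNorm (v5 k).asIdeal = 5 := by
  have hsurj : Function.Surjective (ψ5 (k : ℕ)) := ZMod.ringHom_surjective _
  change Ideal.absNorm (RingHom.ker (ψ5 (k : ℕ))) = 5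
  rw [Ideal.absNorm_apply, Submodule.cardQuot_apply]
  have hc := Nat.card_congr (RingHom.quotientKerEquivOfSurjective hsurj).toEquiv
  rw [Nat.card_zmod] at hc
  exact hc

/-- **The certificate element `β`** (`N(β) = -5⁵`, `β ∈ ker h5 = P₀⁵`). [folklore] -/
def β5 : QuinticCert.Z5 := ⟨-146154, -161041, -147972, -144834, -148609⟩

/-- `β ∈ ker h5`. [folklore] -/
theorem β5_mem : Nat.beq (QuinticCert.Z5.evalMod β5 hom55.c0 hom55.c1 hom55.c2 hom55.c3 hom55.c4 (5 ^ 5)) 0 = true := by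
  decide +kernel

/-- `N(β) = -3125` (norm certificate). [folklore] -/
theorem β5_norm : (QuinticCert.Z5.norm CK2.mul β5).isConst (-3125) = true := by decide +kernel

/-- **The conjugates `βₖ = σᵏ β ∈ 𝓞 K`** (as shifted certificate elements). [folklore] -/
def βO (k : Fin 5) : 𝓞 K := integerEquiv (((shiftInv isSymmetry_shiftInv) ^ (5 - (k : ℕ))) (QuinticCert.toT spec β5))

/-- `βₖ ∈ Pₖ⁵`. [folklore] -/
theorem βO_mem (k : Fin 5) : βO k ∈ (v5 k).asIdeal ^ 5 := by
  have h5 := reads.ker_homRot_pow_five integerEquiv isSymmetry_shiftInv Nat.prime_five homFor_five isHom_55 hom55_reduces (k : ℕ)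
  have hm := reads.conj_mem_ker_homRot integerEquiv isSymmetry_shiftInv (pow_pos Nat.prime_five.pos 5) isHom_55 β5_mem (k : ℕ)
    (by have := k.2; omega)
  rw [h5] at hm
  exact hm

/-- `N(βₖ) = -3125`. [folklore] -/
theorem norm_βO (k : Fin 5) : Algebra.norm ℤ (βO k) = -3125 :=
  norm_shiftInv_pow_toT (C := CK2) integerEquiv isSymmetry_shiftInv hnorm hnormShift β5 (-3125) β5_norm (5 - (k : ℕ))

/-- `βₖ ≠ 0`. [folklore] -/
theorem βO_ne_zero (k : Fin 5) : βO k ≠ 0 := fun h => by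
  have := norm_βO k
  rw [h, Algebra.norm_zero] at this
  norm_num at this

/-- **`(βₖ) = Pₖ⁵`** (`βₖ ∈ Pₖ⁵` and both have norm `5⁵`). [folklore] -/
theorem span_βO (k : Fin 5) : Ideal.span {βO k} = (v5 k).asIdeal ^ 5 := by
  obtain ⟨J, hJ⟩ := Ideal.dvd_iff_le.mpr ((Ideal.span_singleton_le_iff_mem _).mpr (βO_mem k))
  have hN : Ideal.absNorm (Ideal.span {βO k}) = 5 ^ 5 := by
    rw [Ideal.absNorm_span_singleton, norm_βO]; rfl
  have hNJ : Ideal.absNorm J = 1 := by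
    have h := hN
    rw [hJ, map_mul, map_pow, absNorm_v5] at h
    have : (5 : ℕ) ^ 5 * Ideal.absNorm J = 5 ^ 5 * 1 := by rw [mul_one]; exact h
    exact Nat.eq_of_mul_eq_mul_left (by norm_num) this
  rw [Ideal.absNorm_eq_one_iff] at hNJ
  rw [hJ, hNJ, Ideal.mul_top]

/-- **`βₖ` as an element of `K` is `σᵏ β₀`**: coordinates. [folklore] -/
def βTab : Fin 5 → R := ![⟨![-146154, -161041, -147972, -144834, -148609]⟩, ⟨![-148609, -146154, -161041, -147972, -144834]⟩, ⟨![-144834, -148609, -146154, -161041, -147972]⟩, ⟨![-147972, -144834, -148609, -146154, -161041]⟩, ⟨![-161041, -147972, -144834, -148609, -146154]⟩]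

/-- `shiftInv^{5-k} β = βTab k` (kernel computation). [folklore] -/
theorem shiftInv_pow_β5 : ∀ k : Fin 5, ((shiftInv isSymmetry_shiftInv) ^ (5 - (k : ℕ))) (QuinticCert.toT spec β5) = βTab k := by
  decide +kernel

/-- `βₖ = liftO (βTab k)`. [folklore] -/
theorem βO_eq (k : Fin 5) : βO k = liftO (βTab k) := by
  rw [βO, shiftInv_pow_β5]; rfl

/-- `βTab k = shiftᵏ (βTab 0)` (kernel computation). [folklore] -/
theorem βTab_eq_shift : ∀ k : Fin 5, βTab k = shift^[(k : ℕ)] (βTab 0) := by decide +kernel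

/-- **`βₖ = σᵏ β₀` in `K`.** [folklore] -/
theorem coe_βO (k : Fin 5) : ((βO k : 𝓞 K) : K) = σ^[(k : ℕ)] ((βO 0 : 𝓞 K) : K) := by
  rw [βO_eq k, βO_eq 0, coe_liftO, coe_liftO, βTab_eq_shift k, σ_iterate_liftK, βTab_eq_shift 0,
    show ((0 : Fin 5) : ℕ) = 0 from rfl, Function.iterate_zero_apply]

/-- **The five primes above `5` are distinct** (`ψ5 l (βₖ) ≠ 0` for `l ≠ k`, a kernel check). [folklore] -/
theorem v5_ne {k l : Fin 5} (hkl : k ≠ l) : (v5 k).asIdeal ≠ (v5 l).asIdeal := by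
  intro h
  have hmem : βO k ∈ (v5 k).asIdeal := Ideal.pow_le_self (by norm_num) (βO_mem k)
  rw [h] at hmem
  change βO k ∈ RingHom.ker (ψ5 (l : ℕ)) at hmem
  rw [RingHom.mem_ker, βO_eq, ψ5_liftO] at hmem
  have key : ∀ k l : Fin 5, k ≠ l → ψfun l (βTab k) ≠ 0 := by decide
  exact key k l hkl hmem

/-! ### Valuations of `βₖ` -/

/-- **`ord_{Pₖ}(βₖ) = 5`.** [folklore] -/
theorem valuation_βO_self (k : Fin 5) : (v5 k).valuation K ((βO k : 𝓞 K) : K) = WithZero.exp (-5 : ℤ) := by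
  rw [show ((βO k : 𝓞 K) : K) = algebraMap (𝓞 K) K (βO k) from rfl, valuation_of_algebraMap,
    intValuation_eq_exp_neg_multiplicity _ (βO_ne_zero k), span_βO]
  congr 2
  have hP : Prime (v5 k).asIdeal := (v5 k).prime
  rw [multiplicity_pow_self hP.ne_zero hP.not_unit]
  rfl

/-- **`ord_{P_l}(βₖ) = 0` for `l ≠ k`.** [folklore] -/
theorem valuation_βO_other {k l : Fin 5} (hkl : k ≠ l) : (v5 l).valuation K ((βO k : 𝓞 K) : K) = 1 := by
  rw [show ((βO k : 𝓞 K) : K) = algebraMap (𝓞 K) K (βO k) from rfl, valuation_of_algebraMap,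
    intValuation_eq_exp_neg_multiplicity _ (βO_ne_zero k), span_βO, ← WithZero.exp_zero]
  congr 1
  rw [neg_eq_zero, Int.natCast_eq_zero, multiplicity_eq_zero]
  intro hdvd
  have hPl : Prime (v5 l).asIdeal := (v5 l).prime
  have h1 : (v5 l).asIdeal ∣ (v5 k).asIdeal := hPl.dvd_of_dvd_pow hdvd
  have h2 : (v5 l).asIdeal = (v5 k).asIdeal :=
    ((v5 k).isPrime.isMaximal (v5 k).ne_bot).eq_of_le (v5 l).isPrime.ne_top (Ideal.le_of_dvd h1) |>.symm
  exact v5_ne hkl h2.symm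

/-- **`βₖ` is a unit away from `5`.** [folklore] -/
theorem valuation_βO_eq_one {v : HeightOneSpectrum (𝓞 K)} (h5 : (5 : 𝓞 K) ∉ v.asIdeal) (k : Fin 5) :
    v.valuation K ((βO k : 𝓞 K) : K) = 1 := by
  rw [show ((βO k : 𝓞 K) : K) = algebraMap (𝓞 K) K (βO k) from rfl, valuation_of_algebraMap, intValuation_eq_one_iff]
  intro hmem
  apply h5
  have hdvd : v.asIdeal ∣ Ideal.span {βO k} := Ideal.dvd_iff_le.mpr ((Ideal.span_singleton_le_iff_mem _).mpr hmem)
  rw [span_βO] at hdvd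
  have h1 : v.asIdeal ∣ (v5 k).asIdeal := v.prime.dvd_of_dvd_pow hdvd
  have h2 : (v5 k).asIdeal ≤ v.asIdeal := Ideal.le_of_dvd h1
  exact h2 (five_mem_v5 k)

/-- `βₖ ∉ (2)`. [folklore] -/
theorem βO_not_mem_span_two (k : Fin 5) : βO k ∉ span {(2 : 𝓞 K)} := by
  intro h
  have hv : v₂.valuation K ((βO k : 𝓞 K) : K) = 1 :=
    valuation_βO_eq_one (fun h5 => by
      have h25 : (1 : 𝓞 K) ∈ v₂.asIdeal := by
        have e : (1 : 𝓞 K) = 5 - 2 * 2 := by norm_num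
        rw [e]
        exact v₂.asIdeal.sub_mem h5 (v₂.asIdeal.mul_mem_left _ (Ideal.mem_span_singleton_self _))
      exact v₂.isPrime.ne_top ((Ideal.eq_top_iff_one _).mpr h25)) k
  rw [show ((βO k : 𝓞 K) : K) = algebraMap (𝓞 K) K (βO k) from rfl, valuation_of_algebraMap, intValuation_eq_one_iff] at hv
  exact hv h

/-- `ord₂(5) = 0`: `5 ∉ (2)`. [folklore] -/
theorem five_not_mem_v₂ : (5 : 𝓞 K) ∉ v₂.asIdeal := fun h5 => by
  have h25 : (1 : 𝓞 K) ∈ v₂.asIdeal := by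
    have e : (1 : 𝓞 K) = 5 - 2 * 2 := by norm_num
    rw [e]
    exact v₂.asIdeal.sub_mem h5 (v₂.asIdeal.mul_mem_left _ (Ideal.mem_span_singleton_self _))
  exact v₂.isPrime.ne_top ((Ideal.eq_top_iff_one _).mpr h25)

/-- **`(5) = P₀ P₁ P₂ P₃ P₄`.** [folklore] -/
theorem span_five_eq_prod : Ideal.span {(5 : 𝓞 K)} = ∏ l : Fin 5, (v5 l).asIdeal := by
  have hdvd : ∀ l : Fin 5, (v5 l).asIdeal ∣ Ideal.span {(5 : 𝓞 K)} := fun l =>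
    Ideal.dvd_iff_le.mpr ((Ideal.span_singleton_le_iff_mem _).mpr (five_mem_v5 l))
  have hmax : ∀ l : Fin 5, (v5 l).asIdeal.IsMaximal := fun l => (v5 l).isPrime.isMaximal (v5 l).ne_bot
  have hcop : Set.Pairwise (↑(Finset.univ : Finset (Fin 5))) (Function.onFun IsCoprime fun l => (v5 l).asIdeal) := by
    intro l _ l' _ hll'
    rw [Function.onFun, Ideal.isCoprime_iff_sup_eq]
    exact (hmax l).coprime_of_ne (hmax l') (v5_ne hll')
  have hprod : (∏ l : Fin 5, (v5 l).asIdeal) ∣ Ideal.span {(5 : 𝓞 K)} := Finset.prod_dvd_of_coprime hcop fun l _ => hdvd l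
  obtain ⟨J, hJ⟩ := hprod
  have hN5 : Ideal.absNorm (Ideal.span {(5 : 𝓞 K)}) = 5 ^ 5 := by
    rw [show (5 : 𝓞 K) = ((5 : ℕ) : 𝓞 K) by norm_cast]
    exact QuinticCert.absNorm_span_natCast finrank_K 5
  have hNJ : Ideal.absNorm J = 1 := by
    have h := hN5
    rw [hJ, map_mul, map_prod, Finset.prod_congr rfl (fun l _ => absNorm_v5 l), Finset.prod_const, Finset.card_univ,
      Fintype.card_fin] at h
    have : (5 : ℕ) ^ 5 * Ideal.absNorm J = 5 ^ 5 * 1 := by rw [mul_one]; exact h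
    exact Nat.eq_of_mul_eq_mul_left (by norm_num) this
  rw [Ideal.absNorm_eq_one_iff] at hNJ
  rw [hJ, hNJ, Ideal.mul_top]

/-- **`ord_{Pₖ}(5) = 1`** (`5` is unramified). [folklore] -/
theorem valuation_five (k : Fin 5) : (v5 k).valuation K (5 : K) = WithZero.exp (-1 : ℤ) := by
  have h50 : (5 : 𝓞 K) ≠ 0 := by norm_num
  rw [← map_ofNat (algebraMap (𝓞 K) K) 5, valuation_of_algebraMap]
  -- `P ∣ (5)` and `P² ∤ (5) = P · ∏_{l ≠ k} P_l`
  have h1 : (v5 k).intValuation 5 ≤ WithZero.exp (-(1 : ℕ) : ℤ) := by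
    rw [intValuation_le_pow_iff_dvd, pow_one]
    exact Ideal.dvd_iff_le.mpr ((Ideal.span_singleton_le_iff_mem _).mpr (five_mem_v5 k))
  have h2 : ¬ (v5 k).intValuation 5 ≤ WithZero.exp (-(2 : ℕ) : ℤ) := by
    rw [intValuation_le_pow_iff_dvd, span_five_eq_prod, ← Finset.mul_prod_erase _ _ (Finset.mem_univ k), pow_two]
    intro hdvd
    have hP0 : (v5 k).asIdeal ≠ 0 := (v5 k).ne_bot
    have h' : (v5 k).asIdeal ∣ ∏ l ∈ Finset.univ.erase k, (v5 l).asIdeal := (mul_dvd_mul_iff_left hP0).mp hdvd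
    obtain ⟨l, hl, hkl⟩ := (Prime.dvd_finsetProd_iff (v5 k).prime _).mp h'
    have hne : l ≠ k := Finset.ne_of_mem_erase hl
    have hle : (v5 l).asIdeal ≤ (v5 k).asIdeal := Ideal.le_of_dvd hkl
    exact v5_ne hne (((v5 l).isPrime.isMaximal (v5 l).ne_bot).eq_of_le (v5 k).isPrime.ne_top hle)
  obtain ⟨m, hm⟩ : ∃ m : ℕ, (v5 k).intValuation 5 = WithZero.exp (-(m : ℤ)) :=
    ⟨_, (v5 k).intValuation_if_neg h50⟩
  rw [hm] at h1 h2 ⊢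
  rw [WithZero.exp_le_exp] at h1 h2
  congr 1
  omega

/-! ### The real signs of `β₀` and of its conjugates -/

/-- `N(β₀) = -3125` in `ℚ`. [folklore] -/
theorem ratNorm_βO_zero : Algebra.norm ℚ ((βO 0 : 𝓞 K) : K) = -3125 := by
  rw [← Algebra.coe_norm_int, norm_βO]; push_cast; rfl

/-- **The real signs of `β₀`**: `+, -, -, -, +` at `emb 0, …, emb 4` (four by linear interval arithmetic,
the last — `|emb 4 β₀| ≈ 4·10⁻⁵` — from `∏ₛ emb s β₀ = N(β₀) < 0`). [folklore] -/
theorem sign_emb_βO_zero :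
    0 < emb 0 ((βO 0 : 𝓞 K) : K) ∧ emb 1 ((βO 0 : 𝓞 K) : K) < 0 ∧ emb 2 ((βO 0 : 𝓞 K) : K) < 0 ∧
      emb 3 ((βO 0 : 𝓞 K) : K) < 0 ∧ 0 < emb 4 ((βO 0 : 𝓞 K) : K) := by
  have h0 := r₀_spec.1; have h1 := r₁_spec.1; have h2 := r₂_spec.1; have h3 := r₃_spec.1
  have h4 := r₄_spec.1
  simp only [Set.mem_Ioo] at h0 h1 h2 h3 h4
  have hev : ∀ s : Fin 5, emb s ((βO 0 : 𝓞 K) : K) = ∑ b, ((βTab 0).coef b : ℝ) * r (π^[(b : ℕ)] s) := fun s => by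
    rw [βO_eq, coe_liftO, emb_liftK]
  have e0 : 0 < emb 0 ((βO 0 : 𝓞 K) : K) := by
    have e : emb 0 ((βO 0 : 𝓞 K) : K) = (-146154 : ℝ) * r₀ + (-161041 : ℝ) * r₃ + (-147972 : ℝ) * r₁ + (-144834 : ℝ) * r₄ + (-148609 : ℝ) * r₂ := by
      rw [hev, Fin.sum_univ_five]
      simp only [βTab, π, Fin.isValue, Matrix.cons_val_zero, Matrix.cons_val_one, Matrix.head_cons, Matrix.cons_val_two,
        Matrix.tail_cons, Matrix.cons_val_three, Matrix.cons_val_four, Function.iterate_succ_apply',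
        Function.iterate_zero_apply, Fin.val_zero, Fin.val_one, Fin.val_two, show ((3 : Fin 5) : ℕ) = 3 from rfl,
        show ((4 : Fin 5) : ℕ) = 4 from rfl, r_0, r_1, r_2, r_3, r_4, Int.cast_ofNat, Int.cast_neg]
    rw [e]
    linarith
  have e1 : emb 1 ((βO 0 : 𝓞 K) : K) < 0 := by
    have e : emb 1 ((βO 0 : 𝓞 K) : K) = (-146154 : ℝ) * r₁ + (-161041 : ℝ) * r₄ + (-147972 : ℝ) * r₂ + (-144834 : ℝ) * r₀ + (-148609 : ℝ) * r₃ := by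
      rw [hev, Fin.sum_univ_five]
      simp only [βTab, π, Fin.isValue, Matrix.cons_val_zero, Matrix.cons_val_one, Matrix.head_cons, Matrix.cons_val_two,
        Matrix.tail_cons, Matrix.cons_val_three, Matrix.cons_val_four, Function.iterate_succ_apply',
        Function.iterate_zero_apply, Fin.val_zero, Fin.val_one, Fin.val_two, show ((3 : Fin 5) : ℕ) = 3 from rfl,
        show ((4 : Fin 5) : ℕ) = 4 from rfl, r_0, r_1, r_2, r_3, r_4, Int.cast_ofNat, Int.cast_neg]
    rw [e]
    linarith
  have e2 : emb 2 ((βO 0 : 𝓞 K) : K) < 0 := by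
    have e : emb 2 ((βO 0 : 𝓞 K) : K) = (-146154 : ℝ) * r₂ + (-161041 : ℝ) * r₀ + (-147972 : ℝ) * r₃ + (-144834 : ℝ) * r₁ + (-148609 : ℝ) * r₄ := by
      rw [hev, Fin.sum_univ_five]
      simp only [βTab, π, Fin.isValue, Matrix.cons_val_zero, Matrix.cons_val_one, Matrix.head_cons, Matrix.cons_val_two,
        Matrix.tail_cons, Matrix.cons_val_three, Matrix.cons_val_four, Function.iterate_succ_apply',
        Function.iterate_zero_apply, Fin.val_zero, Fin.val_one, Fin.val_two, show ((3 : Fin 5) : ℕ) = 3 from rfl,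
        show ((4 : Fin 5) : ℕ) = 4 from rfl, r_0, r_1, r_2, r_3, r_4, Int.cast_ofNat, Int.cast_neg]
    rw [e]
    linarith
  have e3 : emb 3 ((βO 0 : 𝓞 K) : K) < 0 := by
    have e : emb 3 ((βO 0 : 𝓞 K) : K) = (-146154 : ℝ) * r₃ + (-161041 : ℝ) * r₁ + (-147972 : ℝ) * r₄ + (-144834 : ℝ) * r₂ + (-148609 : ℝ) * r₀ := by
      rw [hev, Fin.sum_univ_five]
      simp only [βTab, π, Fin.isValue, Matrix.cons_val_zero, Matrix.cons_val_one, Matrix.head_cons, Matrix.cons_val_two,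
        Matrix.tail_cons, Matrix.cons_val_three, Matrix.cons_val_four, Function.iterate_succ_apply',
        Function.iterate_zero_apply, Fin.val_zero, Fin.val_one, Fin.val_two, show ((3 : Fin 5) : ℕ) = 3 from rfl,
        show ((4 : Fin 5) : ℕ) = 4 from rfl, r_0, r_1, r_2, r_3, r_4, Int.cast_ofNat, Int.cast_neg]
    rw [e]
    linarith

  have hprod : ∏ s : Fin 5, emb s ((βO 0 : 𝓞 K) : K) = -3125 := by
    rw [prod_emb_eq_norm, ratNorm_βO_zero]; norm_num
  rw [Fin.prod_univ_five] at hprod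
  refine ⟨e0, e1, e2, e3, ?_⟩
  by_contra hle
  rw [not_lt] at hle
  -- signs: (+)(-)(-)(-)(≤ 0) ≥ 0, contradiction with the product `-3125`
  have h01 : emb 0 ((βO 0 : 𝓞 K) : K) * emb 1 ((βO 0 : 𝓞 K) : K) < 0 := mul_neg_of_pos_of_neg e0 e1
  have h012 : 0 < emb 0 ((βO 0 : 𝓞 K) : K) * emb 1 ((βO 0 : 𝓞 K) : K) * emb 2 ((βO 0 : 𝓞 K) : K) :=
    mul_pos_of_neg_of_neg h01 e2
  have h0123 : emb 0 ((βO 0 : 𝓞 K) : K) * emb 1 ((βO 0 : 𝓞 K) : K) * emb 2 ((βO 0 : 𝓞 K) : K) * emb 3 ((βO 0 : 𝓞 K) : K) < 0 :=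
    mul_neg_of_pos_of_neg h012 e3
  have hfin : 0 ≤ emb 0 ((βO 0 : 𝓞 K) : K) * emb 1 ((βO 0 : 𝓞 K) : K) * emb 2 ((βO 0 : 𝓞 K) : K) * emb 3 ((βO 0 : 𝓞 K) : K) *
      emb 4 ((βO 0 : 𝓞 K) : K) := mul_nonneg_of_nonpos_of_nonpos h0123.le hle
  linarith

/-- The sign table of `β₀`. [folklore] -/
def sgnβ0 : Fin 5 → SignType := ![1, -1, -1, -1, 1]

/-- `sign (emb s β₀) = sgnβ0 s`. [folklore] -/
theorem sign_emb_βO_zero_eq (s : Fin 5) : SignType.sign (emb s ((βO 0 : 𝓞 K) : K)) = sgnβ0 s := by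
  obtain ⟨e0, e1, e2, e3, e4⟩ := sign_emb_βO_zero
  fin_cases s
  · exact sign_pos e0
  · exact sign_neg e1
  · exact sign_neg e2
  · exact sign_neg e3
  · exact sign_pos e4

/-- **`sign (emb s βₖ) = sgnβ0 (πᵏ s)`.** [folklore] -/
theorem sign_emb_βO (k s : Fin 5) : SignType.sign (emb s ((βO k : 𝓞 K) : K)) = sgnβ0 (π^[(k : ℕ)] s) := by
  rw [coe_βO, emb_σ_iterate, sign_emb_βO_zero_eq]

/-- The product of the `βₖ` selected by the bits of `cm`. [folklore] -/
def B5 (cm : Fin 32) : K := ∏ k : Fin 5, ((βO k : 𝓞 K) : K) ^ bit cm k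

/-- The same product in `𝓞 K`. [folklore] -/
def B5O (cm : Fin 32) : 𝓞 K := ∏ k : Fin 5, (βO k) ^ bit cm k

/-- `B5 cm = B5O cm` in `K`. [folklore] -/
theorem coe_B5O (cm : Fin 32) : ((B5O cm : 𝓞 K) : K) = B5 cm := by
  simp [B5O, B5]

/-- `B5 cm ≠ 0`. [folklore] -/
theorem B5_ne_zero (cm : Fin 32) : B5 cm ≠ 0 :=
  Finset.prod_ne_zero_iff.mpr fun k _ => pow_ne_zero _ (RingOfIntegers.coe_ne_zero_iff.mpr (βO_ne_zero k))

/-- The predicted sign vector of `B5 cm`. [folklore] -/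
def sgnB (cm : Fin 32) (s : Fin 5) : SignType := ∏ k : Fin 5, sgnβ0 (π^[(k : ℕ)] s) ^ bit cm k

/-- `sign (emb s (B5 cm)) = sgnB cm s`. [folklore] -/
theorem sign_emb_B5 (cm : Fin 32) (s : Fin 5) : SignType.sign (emb s (B5 cm)) = sgnB cm s := by
  rw [B5, map_prod]
  have h : SignType.sign (∏ k : Fin 5, emb s (((βO k : 𝓞 K) : K) ^ bit cm k)) =
      ∏ k : Fin 5, SignType.sign (emb s (((βO k : 𝓞 K) : K) ^ bit cm k)) := map_prod signHom _ _
  rw [h, sgnB]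
  refine Finset.prod_congr rfl fun k _ => ?_
  rw [map_pow, sign_pow, sign_emb_βO]

/-- **The unit class forced by positivity**: `nB cm` is the `n'` with `sgnOf n' = sgnB cm`. [folklore] -/
def nB : Fin 32 → Fin 32 := ![0, 8, 31, 23, 1, 9, 30, 22, 2, 10, 29, 21, 3, 11, 28, 20, 4, 12, 27, 19, 5, 13, 26, 18, 6, 14, 25, 17, 7, 15, 24, 16]

/-- `sgnOf (nB cm) = sgnB cm` and uniqueness (kernel check). [folklore] -/
theorem nB_spec : ∀ cm : Fin 32, sgnOf (nB cm) = sgnB cm ∧ ∀ n' : Fin 32, (∀ s, sgnOf n' s * sgnB cm s = 1) → n' = nB cm := by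
  decide +kernel

/-! ### `ψ5 k` on the representative units; the parity pattern `cmOf n` -/

/-- The predicted value `ψ5 k (rep n)`. [folklore] -/
def ψtab (n : Fin 32) (k : Fin 5) : ZMod 5 :=
  (-1) ^ bit n 4 * (ψfun k (shiftTab 0) ^ bit n 0 * ψfun k (shiftTab 1) ^ bit n 1 * ψfun k (shiftTab 2) ^ bit n 2 *
    ψfun k (shiftTab 3) ^ bit n 3)

/-- **`ψ5 k (rep n) = ψtab n k`.** [folklore] -/
theorem ψ5_rep (n : Fin 32) (k : Fin 5) : ψ5 k ((rep n : (𝓞 K)ˣ) : 𝓞 K) = ψtab n k := by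
  rw [rep, Units.val_mul, Units.val_pow_eq_pow_val, Units.val_neg, Units.val_one, Units.coe_prod, Fin.prod_univ_four]
  simp only [Units.val_pow_eq_pow_val, Fin.castSucc_zero, Fin.castSucc_one,
    show (Fin.castSucc (2 : Fin 4) : Fin 5) = 2 from rfl, show (Fin.castSucc (3 : Fin 4) : Fin 5) = 3 from rfl]
  rw [map_mul, map_pow, map_neg, map_one, map_mul, map_mul, map_mul, map_pow, map_pow, map_pow, map_pow]
  simp only [coe_unitv, shift_iterate_vP, ψ5_liftO, ψtab]

/-- **The parity pattern of `ord_{Pₖ}(x + 2)` forced by `x = rep n · A²`**: bit `k` is `1` iff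
`ψ5 k (rep n)` is a non-square. [folklore] -/
def cmOf (n : Fin 32) : Fin 32 :=
  ⟨(if IsSquare (ψtab n 0) then 0 else 1) + 2 * (if IsSquare (ψtab n 1) then 0 else 1) +
    4 * (if IsSquare (ψtab n 2) then 0 else 1) + 8 * (if IsSquare (ψtab n 3) then 0 else 1) +
    16 * (if IsSquare (ψtab n 4) then 0 else 1), by
      split_ifs <;> norm_num⟩

/-- `bit (cmOf n) k = 0 ↔ ψtab n k` is a square (kernel check). [folklore] -/
theorem bit_cmOf : ∀ n : Fin 32, ∀ k : Fin 5, (bit (cmOf n) k = 0 ↔ IsSquare (ψtab n k)) ∧ (bit (cmOf n) k = 0 ∨ bit (cmOf n) k = 1) := by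
  decide

/-- `cmOf 0 = 0` and `nB 0 = 0`. [folklore] -/
theorem cmOf_zero : cmOf 0 = 0 ∧ nB 0 = 0 := by decide


/-! ### The `2`-adic data of the conductor-`2651` field number `2`: the twisted classes `w = u' ∏ βₖ^{cₖ}` -/

/-- `red4 βₖ` (computed externally, verified below). [folklore] -/
def βQ : Fin 5 → Q4 := ![⟨![2, 3, 0, 2, 3]⟩, ⟨![3, 2, 3, 0, 2]⟩, ⟨![2, 3, 2, 3, 0]⟩, ⟨![0, 2, 3, 2, 3]⟩, ⟨![3, 0, 2, 3, 2]⟩]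

/-- `red4 βₖ = βQ k` (kernel computation). [folklore] -/
theorem red4_βO (k : Fin 5) : red4 (βO k) = βQ k := by
  rw [βO_eq, red4_liftO]
  revert k; decide +kernel

/-- **The image in `Q4` of `w = rep (nB (cmOf n)) · ∏ βₖ^{bit (cmOf n) k}`.** [folklore] -/
def wQ (n : Fin 32) : Q4 :=
  repQ (nB (cmOf n)) * (βQ 0 ^ bit (cmOf n) 0 * βQ 1 ^ bit (cmOf n) 1 * βQ 2 ^ bit (cmOf n) 2 * βQ 3 ^ bit (cmOf n) 3 *
    βQ 4 ^ bit (cmOf n) 4)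

/-- `red4 (rep (nB (cmOf n)) · B5O (cmOf n)) = wQ n`. [folklore] -/
theorem red4_wO (n : Fin 32) : red4 ((((rep (nB (cmOf n)) : (𝓞 K)ˣ) : 𝓞 K)) * B5O (cmOf n)) = wQ n := by
  rw [map_mul, red4_rep, B5O, map_prod, Fin.prod_univ_five, wQ]
  simp only [map_pow, red4_βO]

/-- The inverses of `wQ n` (computed externally, verified below). [folklore] -/
def wQinv : Fin 32 → Q4 := ![⟨![1, 1, 1, 1, 1]⟩, ⟨![0, 2, 2, 2, 1]⟩, ⟨![1, 0, 2, 2, 2]⟩, ⟨![1, 0, 0, 3, 1]⟩, ⟨![0, 2, 2, 3, 0]⟩, ⟨![0, 2, 3, 1, 2]⟩, ⟨![0, 3, 3, 1, 2]⟩, ⟨![1, 2, 0, 3, 3]⟩, ⟨![0, 0, 2, 2, 3]⟩, ⟨![3, 1, 2, 0, 2]⟩, ⟨![2, 0, 2, 3, 1]⟩, ⟨![1, 2, 0, 2, 3]⟩, ⟨![3, 1, 1, 0, 0]⟩, ⟨![1, 0, 0, 0, 1]⟩, ⟨![0, 0, 3, 1, 1]⟩, ⟨![2, 2, 2, 1,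 0]⟩, ⟨![1, 1, 1, 1, 1]⟩, ⟨![0, 2, 2, 2, 1]⟩, ⟨![1, 0, 2, 2, 2]⟩, ⟨![1, 0, 0, 3, 1]⟩, ⟨![0, 2, 2, 3, 0]⟩, ⟨![0, 2, 3, 1, 2]⟩, ⟨![0, 3, 3, 1, 2]⟩, ⟨![1, 2, 0, 3, 3]⟩, ⟨![0, 0, 2, 2, 3]⟩, ⟨![3, 1, 2, 0, 2]⟩, ⟨![2, 0, 2, 3, 1]⟩, ⟨![1, 2, 0, 2, 3]⟩, ⟨![3, 1, 1, 0, 0]⟩, ⟨![1, 0, 0, 0, 1]⟩, ⟨![0, 0, 3, 1, 1]⟩, ⟨![2, 2, 2, 1, 0]⟩]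

/-- The inverses of `repQ n · wQ n` (computed externally, verified below). [folklore] -/
def uwQinv : Fin 32 → Q4 := ![⟨![1, 1, 1, 1, 1]⟩, ⟨![0, 0, 1, 0, 3]⟩, ⟨![3, 0, 0, 1, 0]⟩, ⟨![0, 0, 1, 1, 0]⟩, ⟨![2, 0, 3, 2, 2]⟩, ⟨![0, 1, 3, 0, 2]⟩, ⟨![2, 2, 3, 3, 3]⟩, ⟨![3, 2, 0, 3, 2]⟩, ⟨![2, 2, 0, 3, 2]⟩, ⟨![3, 0, 2, 0, 1]⟩, ⟨![2, 0, 1, 3, 0]⟩, ⟨![0, 0, 3, 1, 3]⟩, ⟨![1, 0, 0, 0, 1]⟩, ⟨![0, 2, 2, 2, 3]⟩, ⟨![2, 3, 0, 3, 0]⟩, ⟨![1, 1, 3, 0, 2]⟩, ⟨![3, 3, 3, 3, 3]⟩, ⟨![0, 0, 3, 0, 1]⟩, ⟨![1, 0, 0, 3, 0]⟩, ⟨![0, 0, 3, 3, 0]⟩, ⟨![2, 0, 1, 2, 2]⟩, ⟨![0, 3, 1, 0, 2]⟩, ⟨![2, 2, 1, 1, 1]⟩, ⟨![1, 2, 0,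 1, 2]⟩, ⟨![2, 2, 0, 1, 2]⟩, ⟨![1, 0, 2, 0, 3]⟩, ⟨![2, 0, 3, 1, 0]⟩, ⟨![0, 0, 1, 3, 1]⟩, ⟨![3, 0, 0, 0, 3]⟩, ⟨![0, 2, 2, 2, 1]⟩, ⟨![2, 1, 0, 1, 0]⟩, ⟨![3, 3, 1, 0, 2]⟩]

set_option maxRecDepth 100000 in
set_option maxHeartbeats 0 in
/-- **The finite `2`-adic check for the field number `2`** (over the fifteen candidates `u = repQ n`
with their forced twists `w = wQ n`): the inverses, and no solution of `uS = wS'` (case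
`ord₂ x < 0`) nor of `uS + 2 = wS'`, `uS - 3 = uwS''` (case `ord₂ x = 0`). [folklore] -/
theorem k2_check :
    (candN.all fun n => (mulQ (wQ n) (wQinv n) == 1) && (mulQ (mulQ (repQ n) (wQ n)) (uwQinv n) == 1) &&
      (oddSq4.all fun s => !(List.elem (mulQ (wQinv n) (mulQ (repQ n) s)) oddSq4)) &&
      (oddSq4.all fun s => !(List.elem (mulQ (wQinv n) (mulQ (repQ n) s + 2)) oddSq4) ||
        !(List.elem (mulQ (uwQinv n) (mulQ (repQ n) s - 3)) sq4))) = true := by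
  decide +kernel

/-- The pieces of `k2_check` for a candidate `n`. [folklore] -/
theorem k2_spec {n : Fin 32} (hn : n ∈ candN) :
    wQ n * wQinv n = 1 ∧ repQ n * wQ n * uwQinv n = 1 ∧
    (∀ s ∈ oddSq4, wQinv n * (repQ n * s) ∉ oddSq4) ∧
    (∀ s ∈ oddSq4, wQinv n * (repQ n * s + 2) ∉ oddSq4 ∨ uwQinv n * (repQ n * s - 3) ∉ sq4) := by
  have h := k2_check
  simp only [List.all_eq_true, Bool.and_eq_true, Bool.or_eq_true, beq_iff_eq, Bool.not_eq_true', mulQ_eq] at h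
  obtain ⟨⟨⟨h1, h2⟩, h3⟩, h4⟩ := h n hn
  refine ⟨h1, h2, fun s hs hmem => ?_, fun s hs => ?_⟩
  · have := List.elem_eq_true_of_mem hmem
    rw [h3 s hs] at this
    exact Bool.false_ne_true this
  · rcases h4 s hs with h | h
    · left; intro hmem
      have := List.elem_eq_true_of_mem hmem
      rw [h] at this; exact Bool.false_ne_true this
    · right; intro hmem
      have := List.elem_eq_true_of_mem hmem
      rw [h] at this; exact Bool.false_ne_true this

/-- **Case `ord₂(x) < 0`**: `u S ≠ w S'` for odd squares `S, S'`. [folklore] -/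
theorem no_solution_neg2 {n : Fin 32} (hn : n ∈ candN) {S S' : Q4} (hS : S ∈ oddSq4) (hS' : S' ∈ oddSq4) :
    repQ n * S ≠ wQ n * S' := by
  intro h
  obtain ⟨hinv, -, hneg, -⟩ := k2_spec hn
  apply hneg S hS
  have e : wQinv n * (repQ n * S) = S' := by
    calc wQinv n * (repQ n * S) = wQinv n * (wQ n * S') := by rw [h]
      _ = (wQ n * wQinv n) * S' := by ring
      _ = S' := by rw [hinv, one_mul]
  rw [e]; exact hS'

/-- **Case `ord₂(x) = 0`**: `uS + 2 = wS'` and `uS - 3 = uwS''` have no solution. [folklore] -/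
theorem no_solution_main2 {n : Fin 32} (hn : n ∈ candN) {S S' S'' : Q4} (hS : S ∈ oddSq4)
    (hS' : S' ∈ oddSq4) (hS'' : S'' ∈ sq4) (h1 : repQ n * S + 2 = wQ n * S')
    (h2 : repQ n * S - 3 = repQ n * wQ n * S'') : False := by
  obtain ⟨hinv, hinv2, -, hmain⟩ := k2_spec hn
  rcases hmain S hS with h | h
  · apply h
    have e : wQinv n * (repQ n * S + 2) = S' := by
      calc wQinv n * (repQ n * S + 2) = wQinv n * (wQ n * S') := by rw [h1]
        _ = (wQ n * wQinv n) * S' := by ring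
        _ = S' := by rw [hinv, one_mul]
    rw [e]; exact hS'
  · apply h
    have e : uwQinv n * (repQ n * S - 3) = S'' := by
      calc uwQinv n * (repQ n * S - 3) = uwQinv n * (repQ n * wQ n * S'') := by rw [h2]
        _ = (repQ n * wQ n * uwQinv n) * S'' := by ring
        _ = S'' := by rw [hinv2, one_mul]
    rw [e]; exact hS''

/-! #### The local analysis at the primes above `5` -/

/-- Residue computations in `ℤ/5` (squares: `0, 1, 4`; `2`, `3` are non-squares). [folklore] -/
theorem zmod5_aux :
    (∀ U M T Y N : ZMod 5, U ≠ 0 → M ≠ 0 → T ≠ 0 → Y ≠ 0 → N ≠ 0 →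
      N ^ 2 * T ^ 6 = U * M ^ 2 * (U * M ^ 2 + 2 * T ^ 2) * (U * M ^ 2 - 3 * T ^ 2) * Y ^ 2 → IsSquare U) ∧
    (∀ U M T : ZMod 5, M ≠ 0 → T ≠ 0 → U * M ^ 2 + 2 * T ^ 2 = 0 → ¬ IsSquare U) ∧
    (∀ U N T S : ZMod 5, T ≠ 0 → S ≠ 0 → N ≠ 0 → N ^ 2 * T ^ 2 = U * (2 * T) * (0 - 3 * T) * S ^ 2 → IsSquare U) ∧
    (∀ U M T Y N : ZMod 5, U ≠ 0 → M ≠ 0 → T ≠ 0 → Y ≠ 0 → N ≠ 0 →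
      N ^ 2 * T ^ 6 = U * M ^ 2 * (U * M ^ 2) * (U * M ^ 2) * Y ^ 2 → IsSquare U) := by
  refine ⟨?_, ?_, ?_, ?_⟩ <;> decide

/-- The valuation `w = ord_{Pₖ}`: `w 2 = w 3 = 1`, `w 5 = exp (-1)`. [folklore] -/
theorem w5_basic (k : Fin 5) :
    (v5 k).valuation K (2 : K) = 1 ∧ (v5 k).valuation K (3 : K) = 1 ∧ (v5 k).valuation K (5 : K) = WithZero.exp (-1 : ℤ) := by
  have h5 := five_mem_v5 k
  have h2 : (2 : 𝓞 K) ∉ (v5 k).asIdeal := fun h2 => by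
    have : (1 : 𝓞 K) ∈ (v5 k).asIdeal := by
      have e : (1 : 𝓞 K) = 5 - 2 * 2 := by norm_num
      rw [e]; exact (v5 k).asIdeal.sub_mem h5 ((v5 k).asIdeal.mul_mem_left _ h2)
    exact (v5 k).isPrime.ne_top ((Ideal.eq_top_iff_one _).mpr this)
  have h3 : (3 : 𝓞 K) ∉ (v5 k).asIdeal := fun h3 => by
    have : (1 : 𝓞 K) ∈ (v5 k).asIdeal := by
      have e : (1 : 𝓞 K) = 2 * 3 - 5 := by norm_num
      rw [e]; exact (v5 k).asIdeal.sub_mem ((v5 k).asIdeal.mul_mem_left _ h3) h5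
    exact (v5 k).isPrime.ne_top ((Ideal.eq_top_iff_one _).mpr this)
  exact ⟨by exact_mod_cast (valuation_natCast_eq_one_iff (v5 k) 2).mpr (by exact_mod_cast h2),
    by exact_mod_cast (valuation_natCast_eq_one_iff (v5 k) 3).mpr (by exact_mod_cast h3), valuation_five k⟩

/-- Clearing a `Pₖ`-adic unit denominator: a `w`-unit `z` is `n / t` with `n, t ∈ 𝓞 K ∖ Pₖ`, and then
`ψ5 k n ≠ 0`, `ψ5 k t ≠ 0`. [folklore] -/
theorem exists_unit_frac (k : Fin 5) {z : K} (hz : (v5 k).valuation K z = 1) :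
    ∃ n t : 𝓞 K, ψ5 k t ≠ 0 ∧ ψ5 k n ≠ 0 ∧ z * (t : K) = n := by
  obtain ⟨n, t, hnt⟩ := exists_primeCompl_mul_eq_of_integer (v5 k) z hz.le
  have ht : (t : 𝓞 K) ∉ (v5 k).asIdeal := t.2
  have hvt : (v5 k).valuation K ((t : 𝓞 K) : K) = 1 := by
    rw [show ((t : 𝓞 K) : K) = algebraMap (𝓞 K) K t from rfl, valuation_of_algebraMap, intValuation_eq_one_iff]; exact ht
  have hn : n ∉ (v5 k).asIdeal := by
    intro hn
    have hvn : (v5 k).valuation K ((n : 𝓞 K) : K) < 1 := by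
      rw [show ((n : 𝓞 K) : K) = algebraMap (𝓞 K) K n from rfl, valuation_lt_one_iff_mem]; exact hn
    have : (v5 k).valuation K (z * ((t : 𝓞 K) : K)) = 1 := by rw [map_mul, hz, hvt, mul_one]
    rw [show z * ((t : 𝓞 K) : K) = ((n : 𝓞 K) : K) from hnt] at this
    exact absurd this hvn.ne
  refine ⟨n, t, fun h0 => ht ?_, fun h0 => hn ?_, hnt⟩
  · change (t : 𝓞 K) ∈ RingHom.ker (ψ5 (k : ℕ)); rwa [RingHom.mem_ker]
  · change n ∈ RingHom.ker (ψ5 (k : ℕ)); rwa [RingHom.mem_ker]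

/-- Clearing a denominator of a `w`-integer: `z = n / t`, `t ∉ Pₖ`; `n ∈ Pₖ` iff `w z < 1`. [folklore] -/
theorem exists_int_frac (k : Fin 5) {z : K} (hz : (v5 k).valuation K z < 1) :
    ∃ n t : 𝓞 K, ψ5 k t ≠ 0 ∧ ψ5 k n = 0 ∧ z * (t : K) = n := by
  obtain ⟨n, t, hnt⟩ := exists_primeCompl_mul_eq_of_integer (v5 k) z hz.le
  have ht : (t : 𝓞 K) ∉ (v5 k).asIdeal := t.2
  have hvt : (v5 k).valuation K ((t : 𝓞 K) : K) = 1 := by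
    rw [show ((t : 𝓞 K) : K) = algebraMap (𝓞 K) K t from rfl, valuation_of_algebraMap, intValuation_eq_one_iff]; exact ht
  have hn : n ∈ (v5 k).asIdeal := by
    have hvn : (v5 k).valuation K ((n : 𝓞 K) : K) < 1 := by
      rw [← show z * ((t : 𝓞 K) : K) = ((n : 𝓞 K) : K) from hnt, map_mul, hvt, mul_one]; exact hz
    rwa [show ((n : 𝓞 K) : K) = algebraMap (𝓞 K) K n from rfl, valuation_lt_one_iff_mem] at hvn
  refine ⟨n, t, fun h0 => ht ?_, ?_, hnt⟩
  · change (t : 𝓞 K) ∈ RingHom.ker (ψ5 (k : ℕ)); rwa [RingHom.mem_ker]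
  · change n ∈ RingHom.ker (ψ5 (k : ℕ)) at hn; rwa [RingHom.mem_ker] at hn


/-! ### The curve `480a1 : y² = x(x + 2)(x - 3)` over `K` -/

section Curve

variable {x y : K} (hE : y ^ 2 = x * (x + 2) * (x - 3)) (hy : y ≠ 0)
include hE hy

/-- `x ≠ 0`, `x + 2 ≠ 0`, `x - 3 ≠ 0` for a point with `y ≠ 0`. [folklore] -/
theorem x_ne : x ≠ 0 ∧ x + 2 ≠ 0 ∧ x - 3 ≠ 0 := by
  have h : x * (x + 2) * (x - 3) ≠ 0 := by rw [← hE]; exact pow_ne_zero 2 hy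
  exact ⟨fun h0 => h (by rw [h0]; ring), fun h0 => h (by rw [h0]; ring), fun h0 => h (by rw [h0]; ring)⟩

/-- **`ord_v(x)` is even for every finite place `v`**: off `2, 3` by the parity lemma (also above `5`:
only `v(0 - (-2)) = v(2) = 1` and `v(0 - 3) = 1` are needed), at `(2)`, `(3)` by the norm condition.
[folklore] -/
theorem two_dvd_log_valuation_x (hN : IsSquare (Algebra.norm ℚ x)) (v : HeightOneSpectrum (𝓞 K)) :
    (2 : ℤ) ∣ WithZero.log (v.valuation K x) := by
  obtain ⟨hx0, -, -⟩ := x_ne hE hy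
  by_cases h2 : (2 : 𝓞 K) ∈ v.asIdeal
  · rw [eq_v₂_of_mem h2]
    exact two_dvd_log_valuation_of_isSquare_norm v₂ (p := 2) (by simp [v₂]) hx0 hN
  by_cases h3 : (3 : 𝓞 K) ∈ v.asIdeal
  · rw [eq_v₃_of_mem h3]
    exact two_dvd_log_valuation_of_isSquare_norm v₃ (p := 3) (by simp [v₃]) hx0 hN
  have hv2 : v.valuation K (2 : K) = 1 := by exact_mod_cast (valuation_natCast_eq_one_iff v 2).mpr (by exact_mod_cast h2)
  have hv3 : v.valuation K (3 : K) = 1 := by exact_mod_cast (valuation_natCast_eq_one_iff v 3).mpr (by exact_mod_cast h3)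
  have key := (v.valuation K).two_dvd_log_map_sub_of_sq_eq (e₁ := 0) (e₂ := -2) (e₃ := 3) (x := x) (y := y)
    (by rw [map_zero]; exact zero_le_one) (by simp only [Valuation.map_neg, hv2, le_refl]) (by rw [hv3])
    (by simp only [zero_sub, Valuation.map_neg, hv2]) (by simp only [zero_sub, Valuation.map_neg, hv3]) hx0
    (by rw [hE]; ring)
  rwa [sub_zero] at key

/-- **`x = u A²` with `u = rep n` of norm `+1`** (even weight). [folklore] -/
theorem exists_rep_mul_sq_x (hN : IsSquare (Algebra.norm ℚ x)) :
    ∃ (n : Fin 32) (A : K), A ≠ 0 ∧ x = (((rep n : (𝓞 K)ˣ) : 𝓞 K) : K) * A ^ 2 ∧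
      2 ∣ bit n 0 + bit n 1 + bit n 2 + bit n 3 + bit n 4 := by
  obtain ⟨hx0, -, -⟩ := x_ne hE hy
  obtain ⟨n, A, hA, hxA⟩ := exists_rep_mul_sq_of_two_dvd_log_valuation hx0
    (two_dvd_log_valuation_x hE hy hN)
  refine ⟨n, A, hA, hxA, ?_⟩
  rw [← sum_bit_eq]
  have hNx : Algebra.norm ℚ x = (-1) ^ (∑ i, bit n i) * (Algebra.norm ℚ A) ^ 2 := by
    rw [hxA, map_mul, map_pow, norm_rep]
  have hq : Algebra.norm ℚ A ≠ 0 := Algebra.norm_ne_zero_iff.mpr hA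
  by_contra hodd
  rw [(Nat.not_even_iff_odd.mp (fun h => hodd (even_iff_two_dvd.mp h))).neg_one_pow] at hNx
  have hlt : Algebra.norm ℚ x < 0 := by rw [hNx]; nlinarith [sq_pos_iff.mpr hq]
  linarith [hN.nonneg]

/-- **`ord_v(x + 2)` is even for every finite place `v` away from `5`**: off `2, 5` by the parity lemma
(`e = (-2, 0, 3)`), at `(2)` by `N(x + 2) = □`. [folklore] -/
theorem two_dvd_log_valuation_x_add_two (hN : IsSquare (Algebra.norm ℚ (x + 2))) (v : HeightOneSpectrum (𝓞 K))
    (h5 : (5 : 𝓞 K) ∉ v.asIdeal) : (2 : ℤ) ∣ WithZero.log (v.valuation K (x + 2)) := by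
  obtain ⟨hx0, hx2, -⟩ := x_ne hE hy
  by_cases h2 : (2 : 𝓞 K) ∈ v.asIdeal
  · rw [eq_v₂_of_mem h2]
    exact two_dvd_log_valuation_of_isSquare_norm v₂ (p := 2) (by simp [v₂]) hx2 hN
  have hv2 : v.valuation K (2 : K) = 1 := by exact_mod_cast (valuation_natCast_eq_one_iff v 2).mpr (by exact_mod_cast h2)
  have hv5 : v.valuation K (5 : K) = 1 := by exact_mod_cast (valuation_natCast_eq_one_iff v 5).mpr (by exact_mod_cast h5)
  have hv3 : v.valuation K (3 : K) ≤ 1 := by exact_mod_cast valuation_natCast_le_one v 3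
  have key := (v.valuation K).two_dvd_log_map_sub_of_sq_eq (e₁ := -2) (e₂ := 0) (e₃ := 3) (x := x) (y := y)
    (by simp only [Valuation.map_neg, hv2, le_refl]) (by rw [map_zero]; exact zero_le_one) hv3
    (by simp only [sub_zero, Valuation.map_neg, hv2])
    (by rw [show (-2 : K) - 3 = -5 by norm_num]; simp only [Valuation.map_neg, hv5])
    (by rw [Ne, ← sub_eq_zero, sub_neg_eq_add]; exact hx2) (by rw [hE]; ring)
  rwa [sub_neg_eq_add] at key

/-- **The local condition above `5`.** For a point with `x = rep n · A²`:
`ord_{Pₖ}(x + 2)` is even iff `ψ5 k (rep n)` is a square in `𝔽₅`. (Cases `ord_{Pₖ} A = 0`: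
either `x + 2` is a `Pₖ`-unit and the residues of `y² = x(x+2)(x-3)` force `x ≡ 1, 4`, or
`x ≡ -2 = 3` is a non-residue and then `ord(x+2)` is odd — if it were even and `≥ 2`,
`ord(x - 3) = ord 5 = 1` would make `ord y²` odd; `ord A > 0`: `x + 2`, `x - 3 ≡ 2`, and
`(y/A)² = u(x+2)(x-3)` gives `u ≡ □/4`; `ord A < 0`: rescaling by `5^{ord}` gives `u³ ≡ □`.) [folklore] -/
theorem local_five (k : Fin 5) {n : Fin 32} {A : K} (hA : A ≠ 0)
    (hxA : x = (((rep n : (𝓞 K)ˣ) : 𝓞 K) : K) * A ^ 2) :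
    (2 : ℤ) ∣ WithZero.log ((v5 k).valuation K (x + 2)) ↔ IsSquare (ψ5 k ((rep n : (𝓞 K)ˣ) : 𝓞 K)) := by
  obtain ⟨hx0, hx2, hx3⟩ := x_ne hE hy
  obtain ⟨hw2, hw3, hw5⟩ := w5_basic k
  set w := (v5 k).valuation K with hw
  set uO : 𝓞 K := ((rep n : (𝓞 K)ˣ) : 𝓞 K) with huO
  have hker : ∀ z : 𝓞 K, z ∈ (v5 k).asIdeal ↔ ψ5 k z = 0 := fun z => by
    change z ∈ RingHom.ker (ψ5 (k : ℕ)) ↔ _; rw [RingHom.mem_ker]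
  have hvu : w (uO : K) = 1 := valuation_coe_unit (v5 k) (rep n)
  have hφu : ψ5 k uO ≠ 0 := fun h0 => by
    have hmem : uO ∈ (v5 k).asIdeal := (hker _).mpr h0
    have : w (uO : K) < 1 := by
      rw [hw, show ((uO : 𝓞 K) : K) = algebraMap (𝓞 K) K uO from rfl, valuation_lt_one_iff_mem]; exact hmem
    rw [hvu] at this; exact lt_irrefl _ this
  have hvA0 : w A ≠ 0 := (Valuation.ne_zero_iff w).mpr hA
  have hvx0 : w x ≠ 0 := (Valuation.ne_zero_iff w).mpr hx0
  have hvx20 : w (x + 2) ≠ 0 := (Valuation.ne_zero_iff w).mpr hx2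
  have hvx30 : w (x - 3) ≠ 0 := (Valuation.ne_zero_iff w).mpr hx3
  have hvy0 : w y ≠ 0 := (Valuation.ne_zero_iff w).mpr hy
  have hlx : WithZero.log (w x) = 2 * WithZero.log (w A) := by
    rw [hxA, map_mul, hvu, one_mul, map_pow, WithZero.log_pow, nsmul_eq_mul]; push_cast; ring
  have hly : 2 * WithZero.log (w y) = WithZero.log (w x) + WithZero.log (w (x + 2)) + WithZero.log (w (x - 3)) := by
    have h := congrArg (fun z => WithZero.log (w z)) hE
    simp only [map_pow, map_mul, WithZero.log_pow, nsmul_eq_mul] at h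
    rw [WithZero.log_mul (mul_ne_zero hvx0 hvx20) hvx30, WithZero.log_mul hvx0 hvx20] at h
    push_cast at h
    linarith
  obtain ⟨aux0, aux1, aux2, aux3⟩ := zmod5_aux
  rcases lt_trichotomy (WithZero.log (w A)) 0 with hneg | h0 | hpos
  · ----------------------------------------------------------------
    -- `ord A > 0`: `x ∈ P²`, `x + 2` and `x - 3` are units ≡ 2
    have hvx : w x < 1 := by
      rw [← WithZero.exp_log hvx0, hlx, ← WithZero.exp_zero, WithZero.exp_lt_exp]; omega
    have hvx2 : w (x + 2) = 1 := by rw [add_comm, w.map_add_eq_of_lt_left (by rw [hw2]; exact hvx), hw2]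
    have hvx3 : w (x - 3) = 1 := by
      rw [sub_eq_add_neg, add_comm, w.map_add_eq_of_lt_left (by rw [Valuation.map_neg, hw3]; exact hvx), Valuation.map_neg, hw3]
    refine ⟨fun _ => ?_, fun _ => by rw [hvx2, WithZero.log_one]; exact dvd_zero 2⟩
    -- `Y := y / A` is a unit and `Y² = u (x+2)(x-3)`
    have hY : (y / A) ^ 2 = (uO : K) * (x + 2) * (x - 3) := by
      rw [div_pow, hE, hxA]; field_simp
    have hvY : w (y / A) = 1 := by
      have h2' : WithZero.log (w ((y / A) ^ 2)) = 0 := by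
        rw [hY, map_mul, map_mul, hvu, hvx2, hvx3]; simp
      rw [map_pow, WithZero.log_pow, nsmul_eq_mul] at h2'
      have hY0 : w (y / A) ≠ 0 := (Valuation.ne_zero_iff w).mpr (div_ne_zero hy hA)
      rw [← WithZero.exp_log hY0, show WithZero.log (w (y / A)) = 0 by push_cast at h2'; omega, WithZero.exp_zero]
    obtain ⟨n1, t1, ht1, hn1, h1⟩ := exists_unit_frac k hvY
    obtain ⟨nx, tx, htx, hnx, h2⟩ := exists_int_frac k hvx
    -- identity: `n1² tx² = u (nx + 2 tx)(nx - 3 tx) t1²`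
    have hid : n1 ^ 2 * tx ^ 2 = uO * (nx + 2 * tx) * (nx - 3 * tx) * t1 ^ 2 := by
      apply RingOfIntegers.coe_injective
      simp only [map_mul, map_pow, map_add, map_sub, map_ofNat, ← RingOfIntegers.coe_eq_algebraMap]
      rw [← h1, ← h2]
      linear_combination ((t1 : 𝓞 K) : K) ^ 2 * ((tx : 𝓞 K) : K) ^ 2 * hY
    have hφ := congrArg (ψ5 k) hid
    simp only [map_mul, map_pow, map_add, map_sub, map_ofNat, hnx, zero_add] at hφ
    exact aux2 (ψ5 k uO) (ψ5 k n1) (ψ5 k tx) (ψ5 k t1) htx ht1 hn1 (by linear_combination hφ)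
  · ----------------------------------------------------------------
    -- `ord A = 0`: `x` is a unit
    have hvA : w A = 1 := by rw [← WithZero.exp_log hvA0, h0, WithZero.exp_zero]
    have hvx : w x = 1 := by rw [← WithZero.exp_log hvx0, hlx, h0, mul_zero, WithZero.exp_zero]
    have hvx2le : w (x + 2) ≤ 1 := by
      refine (w.map_add x 2).trans ?_
      rw [hvx, hw2, max_self]
    obtain ⟨nA, tA, htA, hnA, hA1⟩ := exists_unit_frac k hvA
    rcases hvx2le.lt_or_eq with hlt | heq
    · -- `x ≡ -2`: `u` is a non-residue and `ord(x + 2)` is odd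
      have hodd : ¬ (2 : ℤ) ∣ WithZero.log (w (x + 2)) := by
        rintro ⟨e, he⟩
        have hneg : WithZero.log (w (x + 2)) < 0 := by
          rw [← WithZero.exp_lt_exp, WithZero.exp_log hvx20, WithZero.exp_zero]; exact hlt
        have hle2 : w (x + 2) < w (5 : K) := by
          rw [hw5, ← WithZero.exp_log hvx20, WithZero.exp_lt_exp]; omega
        have hvx3 : w (x - 3) = WithZero.exp (-1 : ℤ) := by
          rw [show x - 3 = -5 + (x + 2) by ring, w.map_add_eq_of_lt_left (by rw [Valuation.map_neg]; exact hle2),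
            Valuation.map_neg, hw5]
        have h := hly
        rw [hvx, WithZero.log_one, hvx3, WithZero.log_exp, he] at h
        omega
      refine ⟨fun h => absurd h hodd, fun hsq => ?_⟩
      exfalso
      -- `(x + 2) tA² = u nA² + 2 tA² ∈ P`
      have hmem : ψ5 k (uO * nA ^ 2 + 2 * tA ^ 2) = 0 := by
        rw [← hker]
        have hv : w (((uO * nA ^ 2 + 2 * tA ^ 2 : 𝓞 K)) : K) < 1 := by
          have e : (((uO * nA ^ 2 + 2 * tA ^ 2 : 𝓞 K)) : K) = (x + 2) * (tA : K) ^ 2 := by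
            simp only [map_mul, map_pow, map_add, map_ofNat, ← RingOfIntegers.coe_eq_algebraMap]
            rw [← hA1, hxA]; ring
          rw [e, map_mul, map_pow]
          have hvt : w (tA : K) ≤ 1 := by
            rw [show ((tA : 𝓞 K) : K) = algebraMap (𝓞 K) K tA from rfl, hw, valuation_of_algebraMap]; exact intValuation_le_one _ _
          calc w (x + 2) * w (tA : K) ^ 2 ≤ w (x + 2) * 1 := by gcongr; exact pow_le_one₀ zero_le hvt
            _ < 1 := by rw [mul_one]; exact hlt
        rwa [show (((uO * nA ^ 2 + 2 * tA ^ 2 : 𝓞 K)) : K) = algebraMap (𝓞 K) K (uO * nA ^ 2 + 2 * tA ^ 2) from rfl,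
          hw, valuation_lt_one_iff_mem] at hv
      simp only [map_add, map_mul, map_pow, map_ofNat] at hmem
      exact aux1 (ψ5 k uO) (ψ5 k nA) (ψ5 k tA) hnA htA hmem hsq
    · -- `x + 2` is a unit: all residues are units and `u` is a residue
      refine ⟨fun _ => ?_, fun _ => by rw [heq, WithZero.log_one]; exact dvd_zero 2⟩
      have hvx3 : w (x - 3) = 1 := by
        have hle : w (x - 3) ≤ 1 := by
          refine (w.map_sub x 3).trans ?_
          rw [hvx, hw3, max_self]
        rcases hle.lt_or_eq with hlt3 | h3
        · exfalso
          -- `x + 2 = (x - 3) + 5` would be in `P`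
          have : w (x + 2) < 1 := by
            rw [show x + 2 = (x - 3) + 5 by ring]
            refine (w.map_add _ _).trans_lt (max_lt hlt3 ?_)
            rw [hw5, ← WithZero.exp_zero, WithZero.exp_lt_exp]; norm_num
          rw [heq] at this; exact lt_irrefl _ this
        · exact h3
      have hvy : w y = 1 := by
        have h := hly
        rw [hvx, heq, hvx3, WithZero.log_one] at h
        rw [← WithZero.exp_log hvy0, show WithZero.log (w y) = 0 by omega, WithZero.exp_zero]
      obtain ⟨ny, ty, hty, hny, hy1⟩ := exists_unit_frac k hvy
      -- identity: `ny² tA⁶ = (u nA²)(u nA² + 2tA²)(u nA² - 3tA²) ty²`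
      have hid : ny ^ 2 * tA ^ 6 = uO * nA ^ 2 * (uO * nA ^ 2 + 2 * tA ^ 2) * (uO * nA ^ 2 - 3 * tA ^ 2) * ty ^ 2 := by
        apply RingOfIntegers.coe_injective
        simp only [map_mul, map_pow, map_add, map_sub, map_ofNat, ← RingOfIntegers.coe_eq_algebraMap]
        rw [← hy1, ← hA1]
        linear_combination ((ty : 𝓞 K) : K) ^ 2 * ((tA : 𝓞 K) : K) ^ 6 * hE
          + ((ty : 𝓞 K) : K) ^ 2 * ((tA : 𝓞 K) : K) ^ 6 *
            (x ^ 2 + x * ((uO : K) * A ^ 2) + ((uO : K) * A ^ 2) ^ 2 - (x + (uO : K) * A ^ 2) - 6) * hxA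
      have hφ := congrArg (ψ5 k) hid
      simp only [map_mul, map_pow, map_add, map_sub, map_ofNat] at hφ
      exact aux0 (ψ5 k uO) (ψ5 k nA) (ψ5 k tA) (ψ5 k ty) (ψ5 k ny) hφu hnA htA hty hny (by linear_combination hφ)
  · ----------------------------------------------------------------
    -- `ord A = -M < 0`: rescale by `5^M`
    obtain ⟨M, hM⟩ : ∃ M : ℕ, WithZero.log (w A) = M := ⟨(WithZero.log (w A)).toNat, (Int.toNat_of_nonneg hpos.le).symm⟩
    have hM1 : 1 ≤ M := by omega
    have hvx : (1 : _) < w x := by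
      rw [← WithZero.exp_log hvx0, hlx, ← WithZero.exp_zero, WithZero.exp_lt_exp]; omega
    have hvx2 : w (x + 2) = w x := w.map_add_eq_of_lt_left (by rw [hw2]; exact hvx)
    have hvx3 : w (x - 3) = w x := by
      rw [sub_eq_add_neg]; exact w.map_add_eq_of_lt_left (by rw [Valuation.map_neg, hw3]; exact hvx)
    refine ⟨fun _ => ?_, fun _ => by rw [hvx2, hlx]; exact ⟨WithZero.log (w A), by ring⟩⟩
    -- `A' := A 5^M` is a unit, `Y := y 5^{3M}` is a unit
    have h5M : w ((5 : K) ^ M) = WithZero.exp (-(M : ℤ)) := by rw [map_pow, hw5, ← WithZero.exp_nsmul]; simp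
    have hvA' : w (A * 5 ^ M) = 1 := by
      rw [map_mul, h5M, ← WithZero.exp_log hvA0, ← WithZero.exp_add, hM, add_neg_cancel, WithZero.exp_zero]
    have hvY : w (y * 5 ^ (3 * M)) = 1 := by
      have hy3 : WithZero.log (w y) = 3 * M := by
        have h := hly; rw [hvx2, hvx3, hlx, hM] at h; omega
      rw [map_mul, map_pow, hw5, ← WithZero.exp_nsmul, ← WithZero.exp_log hvy0, ← WithZero.exp_add, hy3]
      simp
    obtain ⟨n1, t1, ht1, hn1, h1⟩ := exists_unit_frac k hvA'
    obtain ⟨n2, t2, ht2, hn2, h2⟩ := exists_unit_frac k hvY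
    -- identity: `n2² t1⁶ = (u n1²)(u n1² + 2·25^M t1²)(u n1² - 3·25^M t1²) t2²`
    have hid : n2 ^ 2 * t1 ^ 6 =
        uO * n1 ^ 2 * (uO * n1 ^ 2 + 2 * 25 ^ M * t1 ^ 2) * (uO * n1 ^ 2 - 3 * 25 ^ M * t1 ^ 2) * t2 ^ 2 := by
      apply RingOfIntegers.coe_injective
      simp only [map_mul, map_pow, map_add, map_sub, map_ofNat, ← RingOfIntegers.coe_eq_algebraMap]
      rw [← h1, ← h2]
      have e25 : (25 : K) ^ M = (5 ^ M) ^ 2 := by rw [← pow_mul, mul_comm, pow_mul]; norm_num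
      have e125 : (5 : K) ^ (3 * M) = (5 ^ M) ^ 3 := by rw [mul_comm, pow_mul]
      rw [e25, e125]
      linear_combination ((t2 : 𝓞 K) : K) ^ 2 * ((t1 : 𝓞 K) : K) ^ 6 * ((5 : K) ^ M) ^ 6 * hE
        + ((t2 : 𝓞 K) : K) ^ 2 * ((t1 : 𝓞 K) : K) ^ 6 * ((5 : K) ^ M) ^ 6 *
          (x ^ 2 + x * ((uO : K) * A ^ 2) + ((uO : K) * A ^ 2) ^ 2 - (x + (uO : K) * A ^ 2) - 6) * hxA
    have h25 : (ψ5 k (25 : 𝓞 K)) ^ M = 0 := by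
      obtain ⟨m, rfl⟩ := Nat.exists_eq_add_of_le hM1
      rw [pow_add, pow_one, map_ofNat, show (25 : ZMod 5) = 0 by decide, zero_mul]
    have hφ := congrArg (ψ5 k) hid
    simp only [map_mul, map_pow, map_add, map_sub, map_ofNat] at hφ
    rw [show ((25 : ZMod 5)) = ψ5 k (25 : 𝓞 K) by rw [map_ofNat], h25] at hφ
    exact aux3 (ψ5 k uO) (ψ5 k n1) (ψ5 k t1) (ψ5 k t2) (ψ5 k n2) hφu hn1 ht1 ht2 hn2 (by linear_combination hφ)

/-! #### `x + 2 = rep n' · ∏ βₖ^{cₖ} · W²` -/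

/-- **`x + 2 = u' · B5 (cmOf n) · W²` with `u' = rep (nB (cmOf n))`**: multiply `x + 2` by the
`βₖ` at which its valuation is odd (exactly the `k` with `ψ5 k (rep n)` a non-square, `local_five`)
to make all valuations even, apply `K(∅,2) = 𝓞ˣ/𝓞ˣ²`, and pin the unit class down by the positivity
of `x + 2` at the five real places. [folklore] -/
theorem x_add_two_eq (hN : IsSquare (Algebra.norm ℚ (x + 2))) {n : Fin 32} {A : K} (hA : A ≠ 0)
    (hxA : x = (((rep n : (𝓞 K)ˣ) : 𝓞 K) : K) * A ^ 2) :
    ∃ W : K, W ≠ 0 ∧ x + 2 = (((rep (nB (cmOf n)) : (𝓞 K)ˣ) : 𝓞 K) : K) * B5 (cmOf n) * W ^ 2 := by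
  obtain ⟨hx0, hx2, -⟩ := x_ne hE hy
  set cm := cmOf n with hcm
  set z : K := (x + 2) * B5 cm with hz
  have hB0 : B5 cm ≠ 0 := B5_ne_zero cm
  have hz0 : z ≠ 0 := mul_ne_zero hx2 hB0
  -- all valuations of `z` are even
  have hval : ∀ v : HeightOneSpectrum (𝓞 K), (2 : ℤ) ∣ WithZero.log (v.valuation K z) := by
    intro v
    have hB : v.valuation K (B5 cm) = ∏ k : Fin 5, v.valuation K ((βO k : 𝓞 K) : K) ^ bit cm k := by
      rw [B5, map_prod]; simp only [map_pow]
    have hBne : ∀ k : Fin 5, v.valuation K ((βO k : 𝓞 K) : K) ≠ 0 := fun k =>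
      (Valuation.ne_zero_iff _).mpr (RingOfIntegers.coe_ne_zero_iff.mpr (βO_ne_zero k))
    have hvx20 : v.valuation K (x + 2) ≠ 0 := (Valuation.ne_zero_iff _).mpr hx2
    have hvB0 : v.valuation K (B5 cm) ≠ 0 := (Valuation.ne_zero_iff _).mpr hB0
    rw [hz, map_mul, WithZero.log_mul hvx20 hvB0]
    by_cases h5 : (5 : 𝓞 K) ∈ v.asIdeal
    · obtain ⟨l, rfl⟩ := exists_eq_v5 h5
      have hBl : (v5 l).valuation K (B5 cm) = (v5 l).valuation K ((βO l : 𝓞 K) : K) ^ bit cm l := by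
        rw [hB]
        exact Finset.prod_eq_single l (fun k _ hkl => by rw [valuation_βO_other hkl, one_pow])
          (fun h => absurd (Finset.mem_univ l) h)
      rw [hBl, valuation_βO_self, WithZero.log_pow, WithZero.log_exp]
      have hloc := local_five hE hy l hA hxA
      rw [ψ5_rep] at hloc
      obtain ⟨hbit, hb01⟩ := bit_cmOf n l
      rcases hb01 with hb | hb
      · rw [show bit cm l = 0 from hb, zero_smul, add_zero]
        exact hloc.mpr (hbit.mp hb)
      · have hodd : ¬ (2 : ℤ) ∣ WithZero.log ((v5 l).valuation K (x + 2)) := fun h2 => by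
          have := hbit.mpr (hloc.mp h2)
          rw [show bit cm l = 1 from hb] at this
          exact absurd this one_ne_zero
        rw [show bit cm l = 1 from hb, one_smul]
        rw [Int.two_dvd_ne_zero] at hodd
        omega
    · have hB1 : v.valuation K (B5 cm) = 1 := by
        rw [hB]
        exact Finset.prod_eq_one fun k _ => by rw [valuation_βO_eq_one h5, one_pow]
      rw [hB1, WithZero.log_one, add_zero]
      exact two_dvd_log_valuation_x_add_two hE hy hN v h5
  obtain ⟨n', W', hW', hzW⟩ := exists_rep_mul_sq_of_two_dvd_log_valuation hz0 hval
  -- `x + 2 = rep n' · (B5 cm)⁻¹ · W'² = rep n' · B5 cm · (W' / B5 cm)²`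
  have hx2eq : x + 2 = (((rep n' : (𝓞 K)ˣ) : 𝓞 K) : K) * B5 cm * (W' / B5 cm) ^ 2 := by
    have : x + 2 = z / B5 cm := by rw [hz, mul_div_cancel_right₀ _ hB0]
    rw [this, hzW]
    field_simp
  -- positivity pins down `n'`
  have hn' : n' = nB cm := by
    refine (nB_spec cm).2 n' fun s => ?_
    have hpos := emb_x_add_two_pos hE hy s
    rw [hx2eq, map_mul, map_mul, map_pow] at hpos
    have hW0 : emb s (W' / B5 cm) ≠ 0 := (_root_.map_ne_zero _).mpr (div_ne_zero hW' hB0)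
    have hsq : 0 < (emb s (W' / B5 cm)) ^ 2 := lt_of_le_of_ne (sq_nonneg _) (Ne.symm (pow_ne_zero 2 hW0))
    have hpos' : 0 < emb s (((rep n' : (𝓞 K)ˣ) : 𝓞 K) : K) * emb s (B5 cm) := (mul_pos_iff_of_pos_right hsq).mp hpos
    have hs := congrArg SignType.sign (show emb s (((rep n' : (𝓞 K)ˣ) : 𝓞 K) : K) * emb s (B5 cm) = _ from rfl)
    rw [← congrFun (sgn5_rep n') s, ← sign_emb_B5, sgn5, ← sign_mul]
    exact sign_pos hpos'
  subst hn'
  exact ⟨W' / B5 cm, div_ne_zero hW' hB0, hx2eq⟩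

end Curve

/-! ### The `2`-adic obstruction: reduction to `𝓞/4` -/

section TwoAdic

/-- An element of `𝓞 K` outside `(2)` has odd image in `𝓞/4`. [folklore] -/
theorem isOdd_of_not_mem {z : 𝓞 K} (hz : z ∉ span {(2 : 𝓞 K)}) : IsOdd (red4 z) :=
  isOdd_of_not_two_dvd (by rwa [Ideal.mem_span_singleton] at hz)

/-- **Core of case `ord₂(x) = 0`** (twisted form). If `α u² + 2e² = ω w²` and `α u² - 3e² = α ω c²` in
`𝓞 K` with `u, w ∉ (2)`, `red4(e)² = 1`, `red4 α = repQ n` a candidate and `red4 ω = wQ n` its twisted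
class, contradiction (`no_solution_main2`). [folklore] -/
theorem core_main {αO wO u w c e : 𝓞 K} {n : Fin 32} (hn : n ∈ candN) (hα : red4 αO = repQ n) (hwq : red4 wO = wQ n)
    (hu : u ∉ span {(2 : 𝓞 K)}) (hw : w ∉ span {(2 : 𝓞 K)}) (he : red4 e * red4 e = 1)
    (h1 : αO * u ^ 2 + 2 * e ^ 2 = wO * w ^ 2) (h2 : αO * u ^ 2 - 3 * e ^ 2 = αO * wO * c ^ 2) : False := by
  have e1 := congrArg red4 h1
  have e2 := congrArg red4 h2
  simp only [map_add, map_sub, map_mul, map_ofNat, pow_two, he, mul_one, hα, hwq] at e1 e2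
  exact no_solution_main2 hn (sq_mem_oddSq4 _ (isOdd_of_not_mem hu)) (sq_mem_oddSq4 _ (isOdd_of_not_mem hw))
    (sq_mem_sq4 (red4 c)) e1 (by linear_combination e2)

/-- **Core of case `ord₂(x) < 0`** (twisted form): `α u² + 2·4^M e² = ω w²` (`M ≥ 1`) with `u, w ∉ (2)`,
`red4 α = repQ n` a candidate and `red4 ω = wQ n`: contradiction (`no_solution_neg2`; `4^M = 0` in `𝓞/4`).
[folklore] -/
theorem core_neg {αO wO u w e : 𝓞 K} {n : Fin 32} (hn : n ∈ candN) (hα : red4 αO = repQ n) (hwq : red4 wO = wQ n)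
    (hu : u ∉ span {(2 : 𝓞 K)}) (hw : w ∉ span {(2 : 𝓞 K)}) {M : ℕ} (hM : 1 ≤ M)
    (h1 : αO * u ^ 2 + 2 * 4 ^ M * e ^ 2 = wO * w ^ 2) : False := by
  have e1 := congrArg red4 h1
  have h4M : (4 : Q4) ^ M = 0 := by
    obtain ⟨m, rfl⟩ := Nat.exists_eq_add_of_le hM
    rw [pow_add, pow_one, four_eq_zero, zero_mul]
  simp only [map_add, map_mul, map_pow, map_ofNat, pow_two, h4M, mul_zero, zero_mul, add_zero, hα, hwq] at e1
  exact no_solution_neg2 hn (sq_mem_oddSq4 _ (isOdd_of_not_mem hu)) (sq_mem_oddSq4 _ (isOdd_of_not_mem hw)) e1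

/-- An odd rational integer is not in `(2) ⊂ 𝓞 K` (reduce `d = 2e` modulo `2` via `red42 ∘ red4`).
[folklore] -/
theorem intCast_not_mem_span_two {d : ℤ} (hd : Odd d) :
    ((d : ℤ) : 𝓞 K) ∉ span {(2 : 𝓞 K)} := by
  intro hmem
  rw [Ideal.mem_span_singleton] at hmem
  obtain ⟨e, he⟩ := hmem
  obtain ⟨k, rfl⟩ := hd
  have h := congrArg (red42.comp red4) he
  simp only [RingHom.comp_apply, map_intCast, map_mul, map_ofNat] at h
  have h2 : (2 : Q2) = 0 := by decide +kernel
  rw [h2, zero_mul] at h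
  have h1 : ((2 * k + 1 : ℤ) : Q2) = 1 := by
    push_cast
    rw [h2, zero_mul, zero_add]
  rw [h1] at h
  exact absurd h (by decide +kernel)

/-- For an odd integer `d`, `red4(d)² = 1` in `𝓞/4` (`(2k+1)² = 4(k² + k) + 1 ≡ 1 (mod 4)`). [folklore] -/
theorem ψ_intCast_sq_eq_one {d : ℤ} (hd : Odd d) : red4 (d : 𝓞 K) * red4 (d : 𝓞 K) = 1 := by
  obtain ⟨k, rfl⟩ := hd
  rw [map_intCast]
  have e : ((2 * k + 1 : ℤ) : Q4) * ((2 * k + 1 : ℤ) : Q4) = 4 * ((k * k + k : ℤ) : Q4) + 1 := by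
    push_cast; ring
  rw [e, four_eq_zero, zero_mul, zero_add]

/-- `σint` preserves non-membership in `(2)`. [folklore] -/
theorem σint_not_mem_span_two {s : 𝓞 K} (hs : s ∉ span {(2 : 𝓞 K)}) : σint s ∉ span {(2 : 𝓞 K)} := by
  have hv2 : v₂.asIdeal = span {((2 : ℕ) : 𝓞 K)} := by simp [v₂]
  have h1 : v₂.intValuation (σint s) = v₂.intValuation s := intValuation_ringEquiv_eq v₂ hv2 σint s
  intro hmem
  apply hs
  have : v₂.intValuation (σint s) < 1 := (intValuation_lt_one_iff_mem _ _).mpr hmem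
  rw [h1] at this
  exact (intValuation_lt_one_iff_mem _ _).mp this

/-- The norm of `s ∈ 𝓞 K` as an element of `𝓞 K`: `N(s) = ∏_{i<5} σⁱ s`. [folklore] -/
theorem intCast_norm_eq (s : 𝓞 K) :
    ((Algebra.norm ℤ s : ℤ) : 𝓞 K) =
      s * σint s * σint (σint s) * σint (σint (σint s)) * σint (σint (σint (σint s))) := by
  apply RingOfIntegers.coe_injective
  have h := norm_eq_prod_pow_σ (s : K)
  rw [Fin.prod_univ_five] at h
  simp only [σ_pow_apply, Fin.val_zero, Fin.val_one, Fin.val_two, show ((3 : Fin 5) : ℕ) = 3 from rfl,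
    show ((4 : Fin 5) : ℕ) = 4 from rfl, Function.iterate_succ_apply', Function.iterate_zero_apply] at h
  rw [← Algebra.coe_norm_int s, eq_ratCast, Rat.cast_intCast] at h
  calc (((Algebra.norm ℤ s : ℤ) : 𝓞 K) : K) = ((Algebra.norm ℤ s : ℤ) : K) := by rfl
    _ = (s : K) * σ (s : K) * σ (σ (s : K)) * σ (σ (σ (s : K))) * σ (σ (σ (σ (s : K)))) := h
    _ = ((s * σint s * σint (σint s) * σint (σint (σint s)) * σint (σint (σint (σint s))) : 𝓞 K) : K) := by
        push_cast
        simp only [coe_σint]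

/-- A product of two elements outside the prime `(2)` is outside `(2)`. [folklore] -/
theorem mul_not_mem_span_two {a b : 𝓞 K} (ha : a ∉ span {(2 : 𝓞 K)}) (hb : b ∉ span {(2 : 𝓞 K)}) :
    a * b ∉ span {(2 : 𝓞 K)} := fun h => by
  rcases (span_two.1.isPrime).mem_or_mem h with h1 | h2
  · exact ha h1
  · exact hb h2

/-- **`2`-adic units of `K` have odd integral denominators.** If `v₂(z) ≤ 1` then `z · d = w` for some
`w ∈ 𝓞 K` and some ODD `d ∈ ℤ`, and `w ∉ (2)` when `v₂(z) = 1`: write `z = n/s` with `s ∉ (2)` and take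
`d = N(s) = ∏ σⁱ s`, odd because `(2)` is a `σ`-stable prime. [folklore] -/
theorem exists_odd_int_mul_eq {z : K} (hz : v₂.valuation K z ≤ 1) :
    ∃ (w : 𝓞 K) (d : ℤ), Odd d ∧ z * (d : K) = (w : K) ∧ (v₂.valuation K z = 1 → w ∉ span {(2 : 𝓞 K)}) := by
  obtain ⟨n, s, hns⟩ := exists_primeCompl_mul_eq_of_integer v₂ z hz
  have hs : (s : 𝓞 K) ∉ span {(2 : 𝓞 K)} := s.2
  haveI := span_two.1.isPrime
  set c : 𝓞 K := σint s * σint (σint s) * σint (σint (σint s)) * σint (σint (σint (σint s))) with hc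
  have hs1 := σint_not_mem_span_two hs
  have hs2 := σint_not_mem_span_two hs1
  have hs3 := σint_not_mem_span_two hs2
  have hs4 := σint_not_mem_span_two hs3
  have hcnot : c ∉ span {(2 : 𝓞 K)} :=
    mul_not_mem_span_two (mul_not_mem_span_two (mul_not_mem_span_two hs1 hs2) hs3) hs4
  set d : ℤ := Algebra.norm ℤ (s : 𝓞 K) with hd
  have hdO : (d : 𝓞 K) = s * c := by rw [hc, intCast_norm_eq]; ring
  have hdnot : (d : 𝓞 K) ∉ span {(2 : 𝓞 K)} := by rw [hdO]; exact mul_not_mem_span_two hs hcnot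
  have hodd : Odd d := by
    rw [← Int.not_even_iff_odd]
    rintro ⟨k, hk⟩
    apply hdnot
    rw [Ideal.mem_span_singleton]
    exact ⟨k, by rw [hk]; push_cast; ring⟩
  refine ⟨n * c, d, hodd, ?_, fun hz1 => ?_⟩
  · have e : (d : K) = (((d : 𝓞 K)) : K) := by rfl
    rw [e, hdO]
    push_cast
    have hns' : z * ((s : 𝓞 K) : K) = (n : K) := hns
    linear_combination ((c : 𝓞 K) : K) * hns'
  · intro hmem
    rcases (span_two.1.isPrime).mem_or_mem hmem with h1 | h2
    · have hvs : v₂.valuation K ((s : 𝓞 K) : K) = 1 := by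
        rw [show ((s : 𝓞 K) : K) = algebraMap (𝓞 K) K s from rfl, valuation_of_algebraMap, intValuation_eq_one_iff]
        exact hs
      have hvn : v₂.valuation K ((n : 𝓞 K) : K) < 1 := by
        rw [show ((n : 𝓞 K) : K) = algebraMap (𝓞 K) K n from rfl, valuation_lt_one_iff_mem]
        exact h1
      have : v₂.valuation K (z * ((s : 𝓞 K) : K)) = 1 := by rw [map_mul, hz1, hvs, mul_one]
      rw [show z * ((s : 𝓞 K) : K) = ((n : 𝓞 K) : K) from hns] at this
      exact absurd this hvn.ne
    · exact hcnot h2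

/-- `v₂(2) = exp(-1)` (`(2)` is prime, so `2` is a uniformizer). [folklore] -/
theorem valuation_v₂_two : v₂.valuation K (2 : K) = WithZero.exp (-1) := by
  rw [← map_ofNat (algebraMap (𝓞 K) K) 2, valuation_of_algebraMap, v₂.intValuation_singleton (by norm_num) rfl]

/-- In `ℤᵐ⁰`, `log a ≤ 0 ↔ a ≤ 1` for `a ≠ 0`. [folklore] -/
theorem log_nonpos_iff {a : ℤᵐ⁰} (ha : a ≠ 0) : WithZero.log a ≤ 0 ↔ a ≤ 1 := by
  rw [← WithZero.log_one]; exact WithZero.log_le_log ha one_ne_zero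

/-- **The `2`-adic obstruction** (twisted form). Let `α, ω ∈ 𝓞 K ∖ (2)` with `red4 α = repQ n` one of
the fifteen candidates and `red4 ω = wQ n` its twisted class, and suppose `x = α A²`, `x + 2 = ω B²`
(`A, B ∈ Kˣ`) for a point `(x, y)`, `y ≠ 0`, of `y² = x(x+2)(x-3)`. This is impossible: with
`x - 3 = α ω C²`, `C = y/(α ω A B)`, according to `ord₂(A) > 0`, `= 0`, `= -M < 0` one gets
`ord₂(x + 2) = 1` odd, resp. the congruences of `core_main`, resp. `core_neg` modulo `4`, after clearing
odd integral denominators (`exists_odd_int_mul_eq`). [folklore] -/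
theorem two_adic_obstruction {αO wO : 𝓞 K} (hα : αO ∉ span {(2 : 𝓞 K)}) (hwO : wO ∉ span {(2 : 𝓞 K)}) {n : Fin 32}
    (hn : n ∈ candN) (hαψ : red4 αO = repQ n) (hwq : red4 wO = wQ n) {x y A B : K}
    (hE : y ^ 2 = x * (x + 2) * (x - 3)) (hy : y ≠ 0) (hA : A ≠ 0)
    (hB : B ≠ 0) (hxA : x = (αO : K) * A ^ 2) (hxB : x + 2 = (wO : K) * B ^ 2) : False := by
  set v := v₂.valuation K with hv
  have hv2 : v 2 = WithZero.exp (-1) := valuation_v₂_two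
  have hv3 : v (3 : K) ≤ 1 := by exact_mod_cast valuation_natCast_le_one v₂ 3
  have hvα : v (αO : K) = 1 := by
    rw [hv, RingOfIntegers.coe_eq_algebraMap, valuation_of_algebraMap, intValuation_eq_one_iff]; exact hα
  have hvw : v (wO : K) = 1 := by
    rw [hv, RingOfIntegers.coe_eq_algebraMap, valuation_of_algebraMap, intValuation_eq_one_iff]; exact hwO
  have hα0 : ((αO : 𝓞 K) : K) ≠ 0 := fun h0 => by rw [h0, map_zero] at hvα; exact zero_ne_one hvα
  have hw0 : ((wO : 𝓞 K) : K) ≠ 0 := fun h0 => by rw [h0, map_zero] at hvw; exact zero_ne_one hvw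
  obtain ⟨hx0, hx2, hx3⟩ := x_ne hE hy
  -- the third coordinate `x - 3 = α w C²`
  set C : K := y / (((αO : 𝓞 K) : K) * ((wO : 𝓞 K) : K) * A * B) with hC
  have hden : ((αO : 𝓞 K) : K) * ((wO : 𝓞 K) : K) * A * B ≠ 0 := mul_ne_zero (mul_ne_zero (mul_ne_zero hα0 hw0) hA) hB
  have hC0 : C ≠ 0 := div_ne_zero hy hden
  have key : y ^ 2 = (((αO : 𝓞 K) : K) * A ^ 2) * (((wO : 𝓞 K) : K) * B ^ 2) * (x - 3) := by
    rw [← hxA, ← hxB]; exact hE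
  have hxC : x - 3 = ((αO : 𝓞 K) : K) * ((wO : 𝓞 K) : K) * C ^ 2 := by
    have hprod : ((αO : 𝓞 K) : K) * A ^ 2 * (((wO : 𝓞 K) : K) * B ^ 2) ≠ 0 :=
      mul_ne_zero (mul_ne_zero hα0 (pow_ne_zero 2 hA)) (mul_ne_zero hw0 (pow_ne_zero 2 hB))
    have hx3' : x - 3 = y ^ 2 / (((αO : 𝓞 K) : K) * A ^ 2 * (((wO : 𝓞 K) : K) * B ^ 2)) := by
      rw [key, mul_div_cancel_left₀ _ hprod]
    rw [hx3', hC, div_pow]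
    field_simp
  have hvA0 : v A ≠ 0 := (Valuation.ne_zero_iff v).mpr hA
  have hvB0 : v B ≠ 0 := (Valuation.ne_zero_iff v).mpr hB
  have hvC0 : v C ≠ 0 := (Valuation.ne_zero_iff v).mpr hC0
  have hlx2 : WithZero.log (v (x + 2)) = 2 * WithZero.log (v B) := by
    rw [hxB, map_mul, map_pow, hvw, one_mul, WithZero.log_pow, nsmul_eq_mul]; push_cast; ring
  have hlx3 : WithZero.log (v (x - 3)) = 2 * WithZero.log (v C) := by
    rw [hxC, map_mul, map_mul, map_pow, hvα, hvw, one_mul, one_mul, WithZero.log_pow, nsmul_eq_mul]; push_cast; ring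
  have hlx : WithZero.log (v x) = 2 * WithZero.log (v A) := by
    rw [hxA, map_mul, map_pow, hvα, one_mul, WithZero.log_pow, nsmul_eq_mul]; push_cast; ring
  have hvx0 : v x ≠ 0 := (Valuation.ne_zero_iff v).mpr hx0
  have hvx30 : v (x - 3) ≠ 0 := (Valuation.ne_zero_iff v).mpr hx3
  have hxB' : ((αO : 𝓞 K) : K) * A ^ 2 + 2 = ((wO : 𝓞 K) : K) * B ^ 2 := by rw [← hxA]; exact hxB
  have hxC' : ((αO : 𝓞 K) : K) * A ^ 2 - 3 = ((αO : 𝓞 K) : K) * ((wO : 𝓞 K) : K) * C ^ 2 := by rw [← hxA]; exact hxC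
  rcases lt_trichotomy (WithZero.log (v A)) 0 with hlt | heq | hgt
  · -- `ord₂ A ≥ 1`: `v x ≤ exp(-2) < v 2`, so `v(x + 2) = v 2` has odd log
    have hvx : v x < v 2 := by
      rw [← WithZero.exp_log hvx0, hlx, hv2, WithZero.exp_lt_exp]; omega
    have h := congrArg WithZero.log (v.map_add_eq_of_lt_right hvx)
    rw [hlx2, hv2, WithZero.log_exp] at h
    omega
  · -- `ord₂ A = 0`
    have hvA : v A = 1 := by rw [← WithZero.exp_log hvA0, heq, WithZero.exp_zero]
    have hvx : v x = 1 := by rw [← WithZero.exp_log hvx0, hlx, heq, mul_zero, WithZero.exp_zero]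
    have hvx2 : v (x + 2) = 1 := by
      rw [v.map_add_eq_of_lt_left (by rw [hvx, hv2, ← WithZero.exp_zero, WithZero.exp_lt_exp]; norm_num)]
      exact hvx
    have hvB : v B = 1 := by
      have h := congrArg WithZero.log hvx2
      rw [hlx2, WithZero.log_one] at h
      rw [← WithZero.exp_log hvB0, show WithZero.log (v B) = 0 by omega, WithZero.exp_zero]
    have hvx3 : v (x - 3) ≤ 1 := v.map_sub_le hvx.le hv3
    have hvC : v C ≤ 1 := by
      have h := (log_nonpos_iff hvx30).mpr hvx3
      rw [hlx3] at h
      exact (log_nonpos_iff hvC0).mp (by omega)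
    obtain ⟨A₁, dA, hdA, hAd, hA₁⟩ := exists_odd_int_mul_eq hvA.le
    obtain ⟨B₁, dB, hdB, hBd, hB₁⟩ := exists_odd_int_mul_eq hvB.le
    obtain ⟨C₁, dC, hdC, hCd, -⟩ := exists_odd_int_mul_eq hvC
    have hA₁' := hA₁ hvA
    have hB₁' := hB₁ hvB
    have hAd' : A * (dA : K) = algebraMap (𝓞 K) K A₁ := hAd
    have hBd' : B * (dB : K) = algebraMap (𝓞 K) K B₁ := hBd
    have hCd' : C * (dC : K) = algebraMap (𝓞 K) K C₁ := hCd
    have hxB'' : algebraMap (𝓞 K) K αO * A ^ 2 + 2 = algebraMap (𝓞 K) K wO * B ^ 2 := hxB'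
    have hxC'' : algebraMap (𝓞 K) K αO * A ^ 2 - 3 = algebraMap (𝓞 K) K αO * algebraMap (𝓞 K) K wO * C ^ 2 := hxC'
    have h1O : αO * (A₁ * dB * dC) ^ 2 + 2 * ((dA : 𝓞 K) * dB * dC) ^ 2 = wO * (B₁ * dA * dC) ^ 2 := by
      apply RingOfIntegers.coe_injective
      simp only [map_add, map_mul, map_pow, map_ofNat, map_intCast]
      rw [← hAd', ← hBd']
      linear_combination ((dA : K) * dB * dC) ^ 2 * hxB''
    have h2O : αO * (A₁ * dB * dC) ^ 2 - 3 * ((dA : 𝓞 K) * dB * dC) ^ 2 = αO * wO * (C₁ * dA * dB) ^ 2 := by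
      apply RingOfIntegers.coe_injective
      simp only [map_sub, map_mul, map_pow, map_ofNat, map_intCast]
      rw [← hAd', ← hCd']
      linear_combination ((dA : K) * dB * dC) ^ 2 * hxC''
    have he : red4 ((dA : 𝓞 K) * dB * dC) * red4 ((dA : 𝓞 K) * dB * dC) = 1 := by
      have h := ψ_intCast_sq_eq_one ((hdA.mul hdB).mul hdC)
      push_cast at h
      exact h
    exact core_main hn hαψ hwq
      (mul_not_mem_span_two (mul_not_mem_span_two hA₁' (intCast_not_mem_span_two hdB))
        (intCast_not_mem_span_two hdC))
      (mul_not_mem_span_two (mul_not_mem_span_two hB₁' (intCast_not_mem_span_two hdA))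
        (intCast_not_mem_span_two hdC))
      he h1O h2O
  · -- `ord₂ A = -M < 0`, `M ≥ 1`: rescale `A, B` by `2^M`
    obtain ⟨M, hM⟩ : ∃ M : ℕ, WithZero.log (v A) = M :=
      ⟨(WithZero.log (v A)).toNat, (Int.toNat_of_nonneg hgt.le).symm⟩
    have hM1 : 1 ≤ M := by omega
    have hvx : v x = WithZero.exp (2 * (M : ℤ)) := by rw [← WithZero.exp_log hvx0, hlx, hM]
    have hvx2 : v (x + 2) = v x :=
      v.map_add_eq_of_lt_left (by rw [hvx, hv2, WithZero.exp_lt_exp]; omega)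
    have hlB : WithZero.log (v B) = M := by
      have h := congrArg WithZero.log hvx2; rw [hlx2, hvx, WithZero.log_exp] at h; omega
    have hunit : ∀ Z : K, WithZero.log (v Z) = M → v Z ≠ 0 → v (Z * 2 ^ M) = 1 := by
      intro Z hZ hZ0
      have hne : v (Z * 2 ^ M) ≠ 0 := by
        rw [map_mul, map_pow, hv2]; exact mul_ne_zero hZ0 (pow_ne_zero _ (by simp))
      rw [← WithZero.exp_log hne, ← WithZero.exp_zero]
      congr 1
      rw [map_mul, map_pow, WithZero.log_mul hZ0 (pow_ne_zero _ (by rw [hv2]; simp)), WithZero.log_pow, hv2,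
        WithZero.log_exp, hZ, nsmul_eq_mul]
      ring
    have hvA₀ := hunit A hM hvA0
    have hvB₀ := hunit B hlB hvB0
    obtain ⟨A₁, dA, hdA, hAd, hA₁⟩ := exists_odd_int_mul_eq hvA₀.le
    obtain ⟨B₁, dB, hdB, hBd, hB₁⟩ := exists_odd_int_mul_eq hvB₀.le
    have hA₁' := hA₁ hvA₀
    have hB₁' := hB₁ hvB₀
    have e4 : (4 : K) ^ M = (2 ^ M) ^ 2 := by
      rw [← pow_mul, mul_comm, pow_mul]; norm_num
    have hAd' : A * 2 ^ M * (dA : K) = algebraMap (𝓞 K) K A₁ := hAd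
    have hBd' : B * 2 ^ M * (dB : K) = algebraMap (𝓞 K) K B₁ := hBd
    have hxB'' : algebraMap (𝓞 K) K αO * A ^ 2 + 2 = algebraMap (𝓞 K) K wO * B ^ 2 := hxB'
    have h1O : αO * (A₁ * dB) ^ 2 + 2 * 4 ^ M * ((dA : 𝓞 K) * dB) ^ 2 = wO * (B₁ * dA) ^ 2 := by
      apply RingOfIntegers.coe_injective
      simp only [map_add, map_mul, map_pow, map_ofNat, map_intCast]
      rw [← hAd', ← hBd', e4]
      linear_combination ((dA : K) * dB * 2 ^ M) ^ 2 * hxB''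
    exact core_neg hn hαψ hwq (mul_not_mem_span_two hA₁' (intCast_not_mem_span_two hdB))
      (mul_not_mem_span_two hB₁' (intCast_not_mem_span_two hdA)) hM1 h1O

end TwoAdic


/-! ### Assembly -/

/-- `rep n · B5O cm ∉ (2)`. [folklore] -/
theorem rep_mul_B5O_not_mem (n cm : Fin 32) : (((rep n : (𝓞 K)ˣ) : 𝓞 K)) * B5O cm ∉ span {(2 : 𝓞 K)} := by
  refine mul_not_mem_span_two (unit_not_mem_span_two (rep n)) ?_
  rw [B5O]
  refine Finset.prod_induction _ (fun z : 𝓞 K => z ∉ span {(2 : 𝓞 K)}) (fun a b ha hb => mul_not_mem_span_two ha hb)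
    (fun h => span_two.1.ne_top ((Ideal.eq_top_iff_one _).mpr h)) fun k _ => ?_
  induction bit cm k with
  | zero => rw [pow_zero]; exact fun h => span_two.1.ne_top ((Ideal.eq_top_iff_one _).mpr h)
  | succ m ih => rw [pow_succ]; exact mul_not_mem_span_two ih (βO_not_mem_span_two k)

/-- **The norm-`1` `2`-descent statement for `480a1` over `K`** (field number `2`). [folklore] -/
theorem normDescent {x y : K} (hE : y ^ 2 = x * (x + 2) * (x - 3)) (hy : y ≠ 0)
    (hNx : IsSquare (Algebra.norm ℚ x)) (hNx2 : IsSquare (Algebra.norm ℚ (x + 2))) :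
    IsSquare x ∧ IsSquare (x + 2) := by
  obtain ⟨n, A, hA0, hxA, hwt⟩ := exists_rep_mul_sq_x hE hy hNx
  obtain ⟨W, hW0, hxW⟩ := x_add_two_eq hE hy hNx2 hA0 hxA
  by_cases hn : n = 0
  · subst hn
    rw [rep_zero] at hxA
    rw [cmOf_zero.1, cmOf_zero.2, rep_zero] at hxW
    have hB : B5 0 = 1 := by simp [B5, bit]
    rw [hB] at hxW
    refine ⟨⟨A, ?_⟩, ⟨W, ?_⟩⟩
    · rw [hxA]; simp [pow_two]
    · rw [hxW]; simp [pow_two]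
  · exfalso
    set wO : 𝓞 K := ((rep (nB (cmOf n)) : (𝓞 K)ˣ) : 𝓞 K) * B5O (cmOf n) with hwOdef
    have hcoe : (wO : K) = (((rep (nB (cmOf n)) : (𝓞 K)ˣ) : 𝓞 K) : K) * B5 (cmOf n) := by
      simp [hwOdef, B5O, B5]
    have hxW' : x + 2 = (wO : K) * W ^ 2 := by rw [hcoe]; exact hxW
    exact two_adic_obstruction (unit_not_mem_span_two (rep n)) (rep_mul_B5O_not_mem _ _) (mem_candN n hn hwt)
      (red4_rep n) (red4_wO n) hE hy hA0 hW0 hxA hxW'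


section Transport

variable {K' : Type*} [Field K'] [Algebra ℚ K']

/-- `f(z) = z ^ 5 - z ^ 4 - 1060 * z ^ 3 - 18345 * z ^ 2 - 105531 * z - 192589` as the value of `aeval`. [folklore] -/
theorem aeval_quinticPolyRat (z : K') :
    aeval z quinticPolyRat = z ^ 5 - z ^ 4 - 1060 * z ^ 3 - 18345 * z ^ 2 - 105531 * z - 192589 := by
  refine (aeval_map_algebraMap ℚ z quinticPoly).trans ?_
  rw [quinticPoly]
  simp only [map_sub, map_pow, map_mul, aeval_X, map_ofNat]

/-- **The homomorphism `K = ℚ[X]/(f) → K'`, `θ ↦ θ'`**, for a root `θ'` of `f` in a `ℚ`-algebra `K'`.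
[folklore] -/
def algHomOfRoot {θ' : K'} (h : θ' ^ 5 - θ' ^ 4 - 1060 * θ' ^ 3 - 18345 * θ' ^ 2 - 105531 * θ' - 192589 = 0) :
    K →ₐ[ℚ] K' :=
  AdjoinRoot.liftAlgHom quinticPolyRat (Algebra.ofId ℚ K') θ'
    (show aeval θ' quinticPolyRat = 0 by rw [aeval_quinticPolyRat, h])

/-- `algHomOfRoot h θ = θ'`. [folklore] -/
theorem algHomOfRoot_θ {θ' : K'} (h : θ' ^ 5 - θ' ^ 4 - 1060 * θ' ^ 3 - 18345 * θ' ^ 2 - 105531 * θ' - 192589 = 0) :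
    algHomOfRoot h θ = θ' :=
  AdjoinRoot.liftAlgHom_root _ _ _ _

/-- **`K ≃ₐ[ℚ] K'` for every quintic extension `K'/ℚ` containing a root of `f`**: the homomorphism
`θ ↦ θ'` out of the field `K` is injective, hence bijective by `[K : ℚ] = 5 = [K' : ℚ]`. [folklore] -/
def algEquivOfRoot (h5 : Module.finrank ℚ K' = 5) {θ' : K'}
    (h : θ' ^ 5 - θ' ^ 4 - 1060 * θ' ^ 3 - 18345 * θ' ^ 2 - 105531 * θ' - 192589 = 0) : K ≃ₐ[ℚ] K' :=
  haveI : FiniteDimensional ℚ K' := Module.finite_of_finrank_eq_succ h5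
  AlgEquiv.ofBijective (algHomOfRoot h)
    ⟨(algHomOfRoot h).toRingHom.injective,
     (LinearMap.injective_iff_surjective_of_finrank_eq_finrank (f := (algHomOfRoot h).toLinearMap)
        (by rw [finrank_K, h5])).mp (algHomOfRoot h).toRingHom.injective⟩

/-- `algEquivOfRoot h5 h θ = θ'`. [folklore] -/
theorem algEquivOfRoot_θ (h5 : Module.finrank ℚ K' = 5) {θ' : K'}
    (h : θ' ^ 5 - θ' ^ 4 - 1060 * θ' ^ 3 - 18345 * θ' ^ 2 - 105531 * θ' - 192589 = 0) : algEquivOfRoot h5 h θ = θ' :=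
  algHomOfRoot_θ h

/-- Squares are preserved by ring isomorphisms. [folklore] -/
theorem isSquare_map_of_isSquare (g : K ≃ₐ[ℚ] K') {z : K} (hz : IsSquare z) : IsSquare (g z) := by
  obtain ⟨r, hr⟩ := hz
  exact ⟨g r, by rw [hr, map_mul]⟩

/-- **Transport of `normDescent` along `K ≃ₐ[ℚ] K'`** (the curve equation, the norms `N_{·/ℚ}` and
squareness are invariant under `ℚ`-algebra isomorphisms). [folklore] -/
theorem normDescent_of_algEquiv (g : K ≃ₐ[ℚ] K') {x y : K'} (hE : y ^ 2 = x * (x + 2) * (x - 3))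
    (hy : y ≠ 0) (hNx : IsSquare (Algebra.norm ℚ x)) (hNx2 : IsSquare (Algebra.norm ℚ (x + 2))) :
    IsSquare x ∧ IsSquare (x + 2) := by
  set x₀ := g.symm x with hx₀
  set y₀ := g.symm y with hy₀
  have hx : x = g x₀ := (g.apply_symm_apply x).symm
  have hyy : y = g y₀ := (g.apply_symm_apply y).symm
  have hE₀ : y₀ ^ 2 = x₀ * (x₀ + 2) * (x₀ - 3) := by
    apply g.injective
    rw [map_pow, map_mul, map_mul, map_add, map_sub, map_ofNat, map_ofNat, ← hx, ← hyy, hE]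
  have hy₀' : y₀ ≠ 0 := fun h => hy (by rw [hyy, h, map_zero])
  have hN₀ : Algebra.norm ℚ x₀ = Algebra.norm ℚ x := by
    rw [hx, Algebra.norm_eq_of_algEquiv g x₀]
  have hN₂ : Algebra.norm ℚ (x₀ + 2) = Algebra.norm ℚ (x + 2) := by
    rw [← Algebra.norm_eq_of_algEquiv g (x₀ + 2), map_add, map_ofNat, ← hx]
  obtain ⟨h1, h2⟩ := normDescent hE₀ hy₀' (hN₀ ▸ hNx) (hN₂ ▸ hNx2)
  refine ⟨hx ▸ isSquare_map_of_isSquare g h1, ?_⟩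
  have : x + 2 = g (x₀ + 2) := by rw [map_add, map_ofNat, ← hx]
  rw [this]
  exact isSquare_map_of_isSquare g h2

/-- **The norm-`1` `2`-descent of `480a1` over ANY quintic extension `K'/ℚ` generated by a root of
`f = X ^ 5 - X ^ 4 - 1060 * X ^ 3 - 18345 * X ^ 2 - 105531 * X - 192589`** (`= quinticPoly`, i.e. over any copy of the
conductor-`2651` cyclic quintic field number `2` = `CyclicQuintic2651K2.K`, in whatever form it presents itself —
e.g. as a subfield of `ℚ(ζ₂₆₅₁)`): points `(x, y)`, `y ≠ 0`, of `y² = x(x+2)(x-3)` with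
`N(x)`, `N(x + 2) ∈ ℚ²` have `x`, `x + 2 ∈ K'²`. [folklore] -/
theorem normDescent_of_root (h5 : Module.finrank ℚ K' = 5) {θ' : K'}
    (hθ' : θ' ^ 5 - θ' ^ 4 - 1060 * θ' ^ 3 - 18345 * θ' ^ 2 - 105531 * θ' - 192589 = 0) {x y : K'}
    (hE : y ^ 2 = x * (x + 2) * (x - 3)) (hy : y ≠ 0) (hNx : IsSquare (Algebra.norm ℚ x))
    (hNx2 : IsSquare (Algebra.norm ℚ (x + 2))) : IsSquare x ∧ IsSquare (x + 2) :=
  normDescent_of_algEquiv (algEquivOfRoot h5 hθ') hE hy hNx hNx2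

end Transport
end CyclicQuintic2651K2

end Literature.NumberTheory.NumberFields

end
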